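import Literature.MathematicalPhysics.QuantumFieldTheory.Balaban1983to89.B9Ineq3137From149
import Literature.MathematicalPhysics.QuantumFieldTheory.Balaban1983to89.B9Delta2Def134
import Literature.MathematicalPhysics.QuantumFieldTheory.Balaban1983to89.B9Ineq3137LocalSup
import Literature.MathematicalPhysics.QuantumFieldTheory.Balaban1983to89.B11SectG

/-!
# `Balaban1983to89.B9Eq3134MatrixConcrete` — T. Bałaban, *Propagators for lattice gauge theories in a background field*, Commun. Math.
Phys. **99** (1985) 389–434 [Balaban1985BackgroundPropagators], Sect. D, p. 422: **THE MATRIX `𝒞` OF THE QUADRATIC FORM `A ↦ ⟨HC⁽²⁾(A),J⟩`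
OF (3.134), REALISED IN REAL COORDINATES FROM [5]'s CONCRETE SECOND-ORDER TERM `C_j⁽²⁾` ([B7] (136)), with (3.134) and (3.136) PROVED
for p10's `Δ⁽²⁾ = 𝒞 + 𝒞ᵀ` (`B9Delta2Def134.delta2`) and the (149)-display / (3.137) DISCHARGED on it** — the located seam «𝒞 ↔ Σ_j tr-form
of p06's concrete `C_j⁽²⁾` (basis of 𝔤 + level sum)» between the two typed readings of row B9.Eq3.134 (p10 `B9Delta2Def134`, p06
`B9Ineq3137From149`), now a kernel theorem (FILE 74 of the Sect. B–D programme of cell `lit-balaban`, seat r06 = B9 fold owner, gen 27)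

statement-level skeleton of published theorems with citation tags; proofs where landed; nothing here is a claim about the Yang–Mills mass gap

DOCFIX v1.2 (seat r06 gen 28, 2026-08-24; referee ref-4 g85 note D-g85-1, zero weight): HONEST SCOPE (v) now discloses the factor `#lv` carried
by §6's `ℓ^∞` constant (`norm_delta2_calC_mulVec_le`) and §7's block-majorant constant (`hasMaj_delta2_calC_exp`), as the theorems' own statements
already did. Declarations, statements and proofs are byte-identical to the tree copy of record (v1.1 p375766, sha16 449ce49f36c1ffd5).

v1.1 (r06 gen 27, 2026-08-24): APPEND-ONLY — new imports `B9Ineq3137LocalSup` (FILE 75) and `B11SectG` (r16's block-norm vocabulary, which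
carries [4]'s `B6RandomWalk`), and three new sections: §5 the LOCAL-SUPREMUM forms `abs_eq3136_pairing_le_local`, `abs_eq3136_apply_le_local` ((3.137)
p. 423 «and the supremum |A| is taken over several j-blocks surrounding Δ(y)», via FILE 75's `norm_fderiv_secondForm_le_local`/`_single_le_local`);
§6 «small in a proper sense» (p. 423) for the concrete `Δ⁽²⁾` as an `ℓ^∞ → ℓ^∞` bound: `norm_coord_dir_le`, `norm_delta2_calC_mulVec_le`
(`‖Δ⁽²⁾x‖_∞ ≤ θ·‖x‖_∞`, `θ = [2dC₃‖τ‖(Σ‖e_i‖)M_e c₀·#lv]·(Mα₀)`); §7 (section `Majorant`, directions `ι : Type`) THE RANDOM-WALK LETTER: for ANY block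
map `blk : S × ι → 𝔅` into an abstract `B6.Geometry`, `BoxMeets`/`levelRange` (the range bookkeeping), `norm_boxProj_coord_le_of_blockSupp`,
`boxProj_coord_eq_zero_of_not_boxMeets` (locality of `P_c` against block supports), **`hasMajorant_delta2_calC`** (`Δ⁽²⁾` has the FINITE-RANGE
block majorant `K(y,y′) = ‖τ‖M_e(Σ‖e_i‖)Σ_j 2dκ_jC₃(Lʲ)²L^{−jd}𝟙_j(y,y′)` in the sense of [4] (2.51), `B6RandomWalk.HasMajorant`), `pow_budget_collapse`,
**`hasMajorant_delta2_calC_exp`** (under the `(H*J)`-budget and a range hypothesis `d(y,y′) ≤ R` on the boxes: majorant `θ·e^{δR}·e^{−δd(y,y′)}` for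
every `δ ≥ 0`), **`hasMaj_delta2_calC_exp`** (the same as a `B11SectG.HasMaj` between the sharp-block sup sizes — the `hT'` input shape of
`B9SectDL2Decay.rightEntry_majorant` for the `Δ⁽²⁾` summand of the (3.138) perturbation). v1 declarations byte-identical.

CITATION HEADER (lean-in-tree rule).  B9 = [Balaban1985BackgroundPropagators] (held `paper:balaban1985-cmp99-background-propagators`, journal
page = PDF page + 388; page renders `b2b-balaban-ref1/pages/1985-cmp99-background-propagators/…-p033-x2.png`, `…-p034-x2.png`, `…-p035-x2.png`
RE-READ AS IMAGES by this seat 2026-08-24).  p. 421 [PDF 33]: «The function C⁽²⁾(A) is defined at bonds of 𝔅, and on Λ_j it coincides with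
C_j⁽²⁾(LʲηA)—a second order term in the expansion of Q_j(ηA).»; p. 422 [PDF 34]: «To get similar results for G₁, H₁, we have to investigate the
operator determined by the second quadratic form on the right-hand side of (3.128). Let us define ⟨A,Δ⁽²⁾A⟩ = 2⟨HC⁽²⁾(A),J⟩. (3.134) A meaning
of Δ⁽²⁾_π is obvious, it defines the second quadratic form in (3.128), … To find bounds for the operator Δ⁽²⁾ let us write it in the form
Δ⁽²⁾A = Σ_{j=1}^{k} Σ_{b∈Λ_j} (Lʲη)^{d+1} tr (δ/δA) C_j⁽²⁾(A,b)(H\*J)(b). (3.136) From the regularity condition (3.36) and the inequality (3.133) we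
have the estimate |(H\*J)(b)| ≦ O(1)Mα₀(Lʲη)⁻³ for b∈Λ_j. The inequality (149) in [5] implies |⟨δA,Δ⁽²⁾A⟩| ≦ O(1)C₃Mα₀ Σ_{j=0}^{k} Σ_{b∈Λ_j}
(Lʲη)^{d−2}(Q″_j|δA|)(c)|A|_c,»; p. 423 [PDF 35]: «hence |(Δ⁽²⁾A)(b)| ≦ O(1)Mα₀(Lʲη)⁻²|A|, b∈Δ(y), y∈Λ_j, (3.137) and the supremum |A| is taken
over several j-blocks surrounding Δ(y).»  [5] = [Balaban1985Averaging] T. Bałaban, *Averaging operations for lattice gauge theories*, CMP **98**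
(1985) 17–51: (136)–(137) p. 39, (141)–(142) p. 39, (149) p. 40 (as quoted in `B7Eq136SecondOrder` / `B9Ineq3137From149`).  [B11] =
[Balaban1985Variational] (56) p. 286 («symmetric bilinear form obtained by polarization»).  Row **B9.Eq3.134** (cells; the head is the lead's word).

WHY THIS FILE.  Row B9.Eq3.134 is `proved` (lead word Q-B9-26-3, 2026-08-24T01:09:50Z) as the COMPOSITE of two typed readings of the same printed
body: p10's `B9Delta2Def134` over the Sect.-D matrix carrier — *"`𝒞 : Matrix b b ℝ` is the matrix of the quadratic form `A ↦ ⟨HC⁽²⁾(A),J⟩`"*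
(`B9Eq3152` note (b)), `Δ⁽²⁾ := 𝒞 + 𝒞ᵀ` (`delta2`), (3.134) `eq_3134`, (3.136) `eq_3136(_dir/_sum)`, the hence-steps of (3.137) from HYPOTHESES of
printed shape (`ineq3137b_of_149`'s `h149`) — and p06's `B9Ineq3137From149` with [5]'s CONCRETE `C_j⁽²⁾(U₀,·) = B7Eq136SecondOrder.CCovIter2` on the
`ℤᵈ` carrier (`hasFDerivAt_secondForm`, `norm_fderiv_secondForm_le`, `norm_fderiv_secondForm_single_le`).  The lead's word NAMED the one
unbridged point: *«the identification 𝒞 = Σ_j [real-coordinate matrix of tr F_j] (a basis of 𝔤 via `b.repr` + the level sum of `eq_3136_sum`) is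
NOT a kernel theorem — inter-reading glue … HOUSED at rows B9.Eq3.138 / B9.Thm3.12 and FALLS DUE THERE»*.  THIS FILE BRIDGES IT: `𝒞` is DEFINED
WITH BODY from `CCovIter2` (through its symmetric polarization `D²[C_j(U₀, ins_S ·)(c)](0)`, `B7Eq136SecondOrder` §2) in real coordinates along a
finite family `e : ι → 𝔸` (e.g. a real basis of `𝔤 ⊂ 𝔸`), summed over levels and coarse bonds with p06's weights/letters, and (3.134), (3.136),
the (149)-display and (3.137) are PROVED for THIS `𝒞` — p10's `h149` is no longer a hypothesis for the concrete operator.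

DICTIONARY (p06's tree units, `B9Ineq3137From149`: each level rescaled to `ℤᵈ`, fine spacing `1`, coarse spacing `Lʲ`; `Lʲη ↦ Lʲ`, `η^d ↦ 1`;
«b ∈ Λ_j» ↦ a finite set `T_j` of coarse bonds `c = (z, κ)`; «(Lʲη)^{d+1}» ↦ weights `w_j(c) ≥ 0`; «(H\*J)(b)» ↦ an `𝔸`-valued bond function `K_j`;
«(Q″_j f)(c)» ↦ `Σ_s kerQdd L j c s·f_s`; «`|A|·`» ↦ `(Lʲ)²‖a‖`).  NEW HERE: the fine-bond variables `a : S → 𝔸` (`S` a finite set of fine bonds,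
inserted by `B7Prop3Flat.insCfg`) are given REAL COORDINATES `x : S × ι → ℝ`, `A(x)(s) = Σ_i x(s,i)·e_i` (`coord (dir S e) x`; `e : ι → 𝔸` any
finite family — print: a basis of the Lie algebra `𝔤`), so that p10's bond index `b` is `S × ι`; «tr» and the pairing weights `⟨·,·⟩` are ONE
continuous real-linear functional `τ : 𝔸 →L[ℝ] ℝ`; the level sum «Σ_{j=1}^{k}» is a finite set `lv` of levels `j ≤ k`.

WHAT IS PROVED (kernel, 0 sorry, 0 named facts, standard axioms; definitions with bodies + theorems).
* §1 (generic: `E`, `F` normed `ℂ`-spaces, `τ : F →L[ℝ] ℝ`, directions `v : P → E`, a continuous bilinear `B : E →L[ℂ] E →L[ℂ] F`):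
  `coord v x = Σ_p x_p·v_p`; **`realMatrix τ v B`** `= (½τ(B(v_p,v_q)))_{pq}`; `dotProduct_realMatrix_mulVec` (`x ⬝ᵥ 𝒞x = ½τ(B(A(x),A(x)))`);
  `realMatrix_transpose` (symmetric `B` ⇒ `𝒞ᵀ = 𝒞`); `delta2_realMatrix_mulVec_apply(_of_symm)` (`(Δ⁽²⁾x)_p = τ(B(A(x),v_p))`, p10's
  `Δ⁽²⁾ = 𝒞 + 𝒞ᵀ`); `dotProduct_delta2_realMatrix_mulVec(_self)` (`δx ⬝ᵥ Δ⁽²⁾x = τ(B(A(x),A(δx)))`).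
* §2 (concrete, regime of `B7Eq136SecondOrder`/`B9Ineq3137From149` VERBATIM): **`levelForm`** `F_j(a) = Σ_{c∈T_j} w_j(c)·C_j⁽²⁾(U₀, ins_S a)(c)·K_j(c)`
  (= p06's `secondForm`), **`secondFormSum`** `F = Σ_{j∈lv} F_j` («Σ_{j}Σ_{b∈Λ_j}»); `D2` = `D²[C_j(U₀, ins_S ·)(c)](0)`; **`polarLevel`/`polarSum`**
  (the polarization `B` as ONE continuous bilinear map, `polarLevel_apply`/`polarSum_apply`); **`secondFormSum_eq_half_polar`** `F(a) = ½B(a)(a)`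
  (`CCovIter2_ins_eq`); **`polarSum_symm`** (`snd_fderiv_CCovIter_ins_symm`, [B11] (56)); **`hasFDerivAt_secondFormSum`**/`fderiv_secondFormSum`
  `DF(a) = B(a)` = (3.136) for the level sum (`hasFDerivAt_CCovIter2_ins`).
* §3 THE MATRIX: **`calC L U₀ S lv T w K e τ := realMatrix τ (dir S e) (polarSum …)`** (`calC_apply` unfolds it to [5]'s polarizations);
  **`dotProduct_calC_mulVec`** — «𝒞 is the matrix of the quadratic form»: `x ⬝ᵥ 𝒞x = τ(F(A(x)))`; **`eq3134_concrete`** — (3.134)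
  `x ⬝ᵥ Δ⁽²⁾x = 2τ(F(A(x)))` for `Δ⁽²⁾ = delta2 calC`; `calC_transpose`, `delta2_calC` (`Δ⁽²⁾ = 2𝒞`); **`eq3136_concrete`** — (3.136)
  `(Δ⁽²⁾x)_{(s,i)} = τ(DF(A(x))e_{(s,i)})`; `eq3136_concrete_pairing` (`δx ⬝ᵥ Δ⁽²⁾x = τ(DF(A(x))A(δx))`); `delta2_calC_unique` («it defines»:
  p10's `delta2_unique` for the concrete form).
* §4 THE BOUNDS ON THE CONCRETE `Δ⁽²⁾` (regime incl. (145)/(155) smallness, `w ≥ 0`): `norm_fderiv_levelForm_le` (p06's display per level),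
  **`norm_fderiv_secondFormSum_le`** (summed over levels), **`abs_eq3136_pairing_le`** («(149) in [5] implies |⟨δA,Δ⁽²⁾A⟩| ≦ …» with p10's matrix
  pairing on the left), **`h149_concrete`** (p10's hypothesis shape `|δx ⬝ᵥ Δ⁽²⁾x| ≤ Σ_p Γ_p|δx_p|`, `Γ` EXPLICIT: `‖τ‖‖e_i‖Σ_j C₃(Lʲ)²‖A(x)‖Σ_c
  w_j(c)‖K_j(c)‖kerQdd_j(c,s)`), **`abs_eq3136_apply_le`** ((3.137) for the level sum under the `(H\*J)`-budget `w_j‖K_j‖ ≤ κ_j`: `|(Δ⁽²⁾x)_{(s,i)}| ≤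
  ‖τ‖(Σ_j 2dκ_jC₃(Lʲ)²L^{−jd})‖A(x)‖‖e_i‖`, the count dual to [5] (141)/(142) per level), **`ineq3137b_concrete`** ((3.137) AS p10's `Ineq3137b` for
  the concrete `𝒞`, one level `j` («b ∈ Δ(y), y ∈ Λ_j»), budget «(Lʲη)^{d+1}·O(1)Mα₀(Lʲη)⁻³» ↦ `c₀Mα₀(Lʲ)^{d−2}`, `ℓ ≡ Lʲ`, `|A| ↦ (Lʲ)²‖A(x)‖`,
  `O(1) = 2dC₃‖τ‖M_e c₀` with `‖e_i‖ ≤ M_e`; `(Lʲ)^{d−2}(Lʲ)²L^{−jd} = 1` for `d ≥ 2`).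

HONEST SCOPE / NOT CLAIMED.  (i) The objects `H`, `J`, `Λ_j`, `𝔅` of Sect. D are NOT constructed here: exactly as in `B9Delta2Def134` and
`B9Ineq3137From149` they enter as the letters `K_j` («(H\*J)(b)»), `T_j` («Λ_j»), `w_j` («(Lʲη)^{d+1}»); the `(H\*J)`-bound itself (first half of
(3.137)) is `B9Ineq3137Regular`/`B9Delta2Def134.ineq3137a_of_3133_336` (rows 3.133/3.36 by reference) and appears here only as the budget
hypothesis `hK`.  (ii) Real coordinates: `e : ι → 𝔸` is ANY finite family (print: a basis of `𝔤`; the file does not fix `𝔤`, nor require `e` to be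
a basis — for a basis of `𝔤` the coordinates `x` are print's real components of `A ∈ 𝔤^S`); `τ` is any continuous real-linear functional (print:
`tr` with the `η^d`-weighted pairing, `η^d ↦ 1` in tree units).  (iii) Units are p06's (DICTIONARY above); the single-level `Ineq3137b` instance
carries p06's reading `|A| ↦ (Lʲ)²‖a‖` and a uniform scale `ℓ ≡ Lʲ`; the multi-level pointwise bound is `abs_eq3136_apply_le` (a sum over the
levels seeing the fine bond), print's «b ∈ Δ(y), y ∈ Λ_j» localisation of the fine bond to ONE level being a property of the multiscale geometry
`𝔅` not modelled on the flat `ℤᵈ` carrier (located; no claim either way).  (iv) (3.135)/(3.138) (`Δ⁽²⁾_π`, `G₁`) are untouched: p10's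
`delta2pi`/`G1inv_eq_Ginv_sub` apply verbatim to `calC` (they take any `𝒞`).  (v) Smallness «small in a proper sense» is `B9SectDSup`'s input, as
before; v1.1 §6–§7 supply it for the `Δ⁽²⁾` summand in two readings (an `ℓ^∞` operator bound, and the block majorant `θe^{δR}e^{−δd}` of the
random-walk bookkeeping) with EXPLICIT, unoptimised constants, BOTH of the form `O(1)·#lv·Mα₀` (print: `O(1)·Mα₀`) — the extra factor `#lv`
(number of levels seeing the fine bond) because the one-level localisation of the fine bond is `𝔅`'s and is not modelled on the flat carrier,
cf. (iii); located, zero weight.  (vi) §7's block map `blk` and geometry `g` are ARBITRARY (print: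
`𝔅` with `Δ(y) = B^j(y)`), and the range `R` of the boxes in the distance (2.46) is a HYPOTHESIS LETTER `hR` (print: the box of a coarse bond is two
neighbouring `j`-blocks, `R = O(1)`; the flat per-level carrier does not model `𝔅`, cf. (iii)); `M_e ≥ 0` is assumed explicitly there.  NOT summit
progress.

RELATED IN THE TREE, NOT DUPLICATED (searched 2026-08-24: stems `*3134*`, `*3136*`, `*Delta2*`, `*RealCoord*` in `Balaban1983to89/` = only
`B9Delta2Def134`): p10 `B9Delta2Def134` (the abstract `𝒞`, USED here: `delta2`, `eq_3134`,
`delta2_of_symm`, `delta2_unique`, `Ineq3137b`), p06 `B9Ineq3137From149` + `B7Eq136SecondOrder` (the concrete `C_j⁽²⁾`, USED here: `CCovIter2_ins_eq`,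
`snd_fderiv_CCovIter_ins_symm`, `hasFDerivAt_CCovIter2_ins`, `norm_fderiv_secondForm_le`, `norm_fderiv_secondForm_single_le`, `kerQdd_nonneg`),
r06 `B9Ineq3137Regular` (the `(H\*J)`-bound for regular `U`), `B9Eq3130Neumann` v1.1 ((3.138) with `Δ′_π + Δ⁽²⁾_π` as one letter).  Here: the
realisation member only.  Unit `lit-balaban-r06`, HOME `run/shared/lean/pub/lit-balaban/`.
-/

noncomputable section

open scoped BigOperators Topology
open NormedSpace Finset Matrix

namespace Literature.MathematicalPhysics.QuantumFieldTheory.Balaban1983to89.B9Eq3134MatrixConcrete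

open Literature.MathematicalPhysics.QuantumFieldTheory.Balaban1983to89

/-! ## §1 Real coordinates for an `F`-valued quadratic form on a complex space (generic) -/

section RealCoords

variable {E F : Type*} [NormedAddCommGroup E] [NormedSpace ℂ E] [NormedAddCommGroup F] [NormedSpace ℂ F]
variable {P : Type*}

/-- **Real coordinates** — the configuration `A(x) = Σ_p x_p·v_p` with real coordinates `x : P → ℝ` along a finite family
`v : P → E` of directions (print: `A` is `𝔤`-valued, `𝔤` a real vector space with a basis; p10's Sect.-D carrier indexes
these real coordinates by `b`). [cite: Balaban1985BackgroundPropagators, (3.134) p.422] -/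
def coord [Fintype P] (v : P → E) (x : P → ℝ) : E := ∑ p, (x p : ℂ) • v p

omit [NormedSpace ℂ F] [NormedAddCommGroup F] in
/-- `A(x)` unfolded. [cite: Balaban1985BackgroundPropagators, (3.134) p.422] -/
theorem coord_def [Fintype P] (v : P → E) (x : P → ℝ) : coord v x = ∑ p, (x p : ℂ) • v p := rfl

omit [NormedSpace ℂ F] [NormedAddCommGroup F] in
/-- `A(e_p) = v_p`. [cite: Balaban1985BackgroundPropagators, (3.134) p.422] -/
theorem coord_single [Fintype P] [DecidableEq P] (v : P → E) (p : P) : coord v (Pi.single p 1) = v p := by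
  rw [coord, Finset.sum_eq_single p]
  · simp
  · intro q _ hq
    simp [Pi.single_eq_of_ne hq]
  · intro hp
    exact absurd (Finset.mem_univ p) hp

/-- **THE REAL MATRIX `𝒞` OF A QUADRATIC FORM** — for a continuous bilinear `B : E × E → F` and a real-linear functional
`τ : F → ℝ` («tr» composed with the pairing), the matrix of the real quadratic form `x ↦ τ(½B(A(x),A(x)))` in the coordinates
`x`: `𝒞_{pq} = ½τ(B(v_p, v_q))` — p10's *"`𝒞` = the matrix of the quadratic form `A ↦ ⟨HC⁽²⁾(A),J⟩`"* (`B9Eq3152` note (b),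
`B9Delta2Def134`). [cite: Balaban1985BackgroundPropagators, (3.134) p.422] -/
def realMatrix (τ : F →L[ℝ] ℝ) (v : P → E) (B : E →L[ℂ] E →L[ℂ] F) : Matrix P P ℝ :=
  Matrix.of fun p q => (1 / 2 : ℝ) * τ (B (v p) (v q))

/-- `𝒞_{pq}` unfolded. [cite: Balaban1985BackgroundPropagators, (3.134) p.422] -/
theorem realMatrix_apply (τ : F →L[ℝ] ℝ) (v : P → E) (B : E →L[ℂ] E →L[ℂ] F) (p q : P) :
    realMatrix τ v B p q = (1 / 2 : ℝ) * τ (B (v p) (v q)) := rfl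

/-- `τ(B(v, A(x))) = Σ_q x_q τ(B(v, v_q))`. [cite: Balaban1985BackgroundPropagators, (3.134) p.422] -/
theorem τ_apply_coord_right [Fintype P] (τ : F →L[ℝ] ℝ) (v : P → E) (B : E →L[ℂ] E →L[ℂ] F) (u : E) (x : P → ℝ) :
    τ (B u (coord v x)) = ∑ q, x q * τ (B u (v q)) := by
  rw [coord, map_sum, map_sum]
  refine Finset.sum_congr rfl fun q _ => ?_
  rw [map_smul, Complex.coe_smul, map_smul, smul_eq_mul]

/-- `τ(B(A(x), v)) = Σ_q x_q τ(B(v_q, v))`. [cite: Balaban1985BackgroundPropagators, (3.134) p.422] -/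
theorem τ_apply_coord_left [Fintype P] (τ : F →L[ℝ] ℝ) (v : P → E) (B : E →L[ℂ] E →L[ℂ] F) (u : E) (x : P → ℝ) :
    τ (B (coord v x) u) = ∑ q, x q * τ (B (v q) u) := by
  rw [coord, map_sum, _root_.sum_apply, map_sum]
  refine Finset.sum_congr rfl fun q _ => ?_
  rw [map_smul, _root_.smul_apply, Complex.coe_smul, map_smul, smul_eq_mul]

/-- `τ(B(A(x), A(y))) = Σ_p Σ_q x_p y_q τ(B(v_p, v_q))`. [cite: Balaban1985BackgroundPropagators, (3.134) p.422] -/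
theorem τ_apply_coord_coord [Fintype P] (τ : F →L[ℝ] ℝ) (v : P → E) (B : E →L[ℂ] E →L[ℂ] F) (x y : P → ℝ) :
    τ (B (coord v x) (coord v y)) = ∑ p, ∑ q, x p * y q * τ (B (v p) (v q)) := by
  rw [τ_apply_coord_left]
  refine Finset.sum_congr rfl fun p _ => ?_
  rw [τ_apply_coord_right, Finset.mul_sum]
  refine Finset.sum_congr rfl fun q _ => ?_
  ring

/-- **«`𝒞` is the matrix of the quadratic form»**: `x ⬝ᵥ 𝒞x = ½τ(B(A(x), A(x)))` — in print `Aᵀ𝒞A = ⟨HC⁽²⁾(A),J⟩`.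
[cite: Balaban1985BackgroundPropagators, (3.134) p.422] -/
theorem dotProduct_realMatrix_mulVec [Fintype P] (τ : F →L[ℝ] ℝ) (v : P → E) (B : E →L[ℂ] E →L[ℂ] F) (x : P → ℝ) :
    x ⬝ᵥ realMatrix τ v B *ᵥ x = (1 / 2 : ℝ) * τ (B (coord v x) (coord v x)) := by
  rw [τ_apply_coord_coord, Finset.mul_sum]
  simp only [dotProduct, mulVec, realMatrix, of_apply, Finset.mul_sum]
  refine Finset.sum_congr rfl fun p _ => Finset.sum_congr rfl fun q _ => ?_
  ring

/-- For a SYMMETRIC `B` the matrix `𝒞` is symmetric. [cite: Balaban1985BackgroundPropagators, (3.134) p.422] -/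
theorem realMatrix_transpose (τ : F →L[ℝ] ℝ) (v : P → E) (B : E →L[ℂ] E →L[ℂ] F) (hB : ∀ a a', B a a' = B a' a) :
    (realMatrix τ v B)ᵀ = realMatrix τ v B := by
  ext p q
  rw [transpose_apply, realMatrix_apply, realMatrix_apply, hB]

/-- **(3.136) in coordinates (no symmetry needed)**: `(Δ⁽²⁾x)_p = ½τ(B(v_p, A(x))) + ½τ(B(A(x), v_p))` with p10's
`Δ⁽²⁾ = 𝒞 + 𝒞ᵀ` (`B9Delta2Def134.delta2`) — the `p`-th partial derivative of `x ↦ ½τ(B(A(x),A(x)))`.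
[cite: Balaban1985BackgroundPropagators, (3.136) p.422] -/
theorem delta2_realMatrix_mulVec_apply [Fintype P] (τ : F →L[ℝ] ℝ) (v : P → E) (B : E →L[ℂ] E →L[ℂ] F) (x : P → ℝ) (p : P) :
    (B9Delta2Def134.delta2 (realMatrix τ v B) *ᵥ x) p =
      (1 / 2 : ℝ) * τ (B (v p) (coord v x)) + (1 / 2 : ℝ) * τ (B (coord v x) (v p)) := by
  rw [B9Delta2Def134.delta2, add_mulVec, Pi.add_apply, τ_apply_coord_right, τ_apply_coord_left, Finset.mul_sum, Finset.mul_sum]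
  simp only [mulVec, dotProduct, realMatrix, transpose_apply, of_apply]
  congr 1
  · refine Finset.sum_congr rfl fun q _ => ?_
    ring
  · refine Finset.sum_congr rfl fun q _ => ?_
    ring

/-- **(3.136) in coordinates, symmetric `B`**: `(Δ⁽²⁾x)_p = τ(B(A(x), v_p))` — `Δ⁽²⁾A` is the `A`-gradient of `Aᵀ𝒞A`.
[cite: Balaban1985BackgroundPropagators, (3.136) p.422] -/
theorem delta2_realMatrix_mulVec_apply_of_symm [Fintype P] (τ : F →L[ℝ] ℝ) (v : P → E) (B : E →L[ℂ] E →L[ℂ] F)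
    (hB : ∀ a a', B a a' = B a' a) (x : P → ℝ) (p : P) :
    (B9Delta2Def134.delta2 (realMatrix τ v B) *ᵥ x) p = τ (B (coord v x) (v p)) := by
  rw [delta2_realMatrix_mulVec_apply, hB]
  ring

/-- **the pairing `⟨δA, Δ⁽²⁾A⟩ = τ(B(A, δA))`** (symmetric `B`) — the left-hand side of the display after (3.136).
[cite: Balaban1985BackgroundPropagators, (3.136) p.422, (3.137) p.423] -/
theorem dotProduct_delta2_realMatrix_mulVec [Fintype P] (τ : F →L[ℝ] ℝ) (v : P → E) (B : E →L[ℂ] E →L[ℂ] F)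
    (hB : ∀ a a', B a a' = B a' a) (x δx : P → ℝ) :
    δx ⬝ᵥ B9Delta2Def134.delta2 (realMatrix τ v B) *ᵥ x = τ (B (coord v x) (coord v δx)) := by
  rw [τ_apply_coord_right, dotProduct]
  refine Finset.sum_congr rfl fun p _ => ?_
  rw [delta2_realMatrix_mulVec_apply_of_symm τ v B hB]

/-- **(3.134) in coordinates**: `x ⬝ᵥ Δ⁽²⁾x = τ(B(A(x), A(x)))` (= `2·Aᵀ𝒞A`, p10's `eq_3134`).
[cite: Balaban1985BackgroundPropagators, (3.134) p.422] -/
theorem dotProduct_delta2_realMatrix_mulVec_self [Fintype P] (τ : F →L[ℝ] ℝ) (v : P → E) (B : E →L[ℂ] E →L[ℂ] F) (x : P → ℝ) :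
    x ⬝ᵥ B9Delta2Def134.delta2 (realMatrix τ v B) *ᵥ x = τ (B (coord v x) (coord v x)) := by
  rw [B9Delta2Def134.eq_3134, dotProduct_realMatrix_mulVec]
  ring

end RealCoords

/-! ## §2 The concrete form `⟨C⁽²⁾(A), H*J⟩` from [5]'s `C_j⁽²⁾` ([B7] (136)): the multi-level sum, its polarization and
its derivative -/

section Concrete

open NormedSpace Finset Metric Filter
open B7Prop1Explicit B7Prop1Local B7Prop2Explicit B7Prop3Flat B7Prop4Flat B7Eq92Concrete B7Prop3GeneralLinear
  B7Prop4GeneralLevels B7Prop5GeneralOperators B7Prop5GeneralInduction B7Prop5GeneralLevels B7Ineq149Pairing B7Eq136SecondOrder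
  B9Ineq3137From149

variable {d : ℕ}
variable {𝔸 : Type*} [NormedRing 𝔸] [NormedAlgebra ℂ 𝔸] [CompleteSpace 𝔸] [NormOneClass 𝔸]

variable (L : ℕ) (hL : 2 ≤ L) {G : Subgroup 𝔸ˣ} (hG : AvgClosed d L G) (k : ℕ)
  (U₀ : B7Prop1Explicit.Site d → Fin d → 𝔸ˣ) (hU₀ : ∀ x κ, U₀ x κ ∈ G) {α₀ : ℝ} (hα : 0 < α₀)
  (hα3 : C0 d * α₀ ≤ 1 / 3) (hα4 : 4 * α₀ ≤ c2' d L) (h52 : pdev U₀ < α₀ * (((L : ℝ) ^ k)⁻¹) ^ 2)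
  {b : ℝ} (hb : 0 < b)
  (hsmall : Real.exp (4 * (800 * ((d : ℝ) + 1) ^ 2 * ((d : ℝ) + 4)) * α₀)
    * (1 + 8 * (131072 * ((d : ℝ) + 1) ^ 2) * ((L : ℝ) ^ k * b)) ≤ 2)
  (hc₃ : 4 * ((L : ℝ) ^ k * b) < c3 d L)
  (h145 : 8 * d * thetaGen d L α₀ * (L : ℝ)⁻¹ ^ 4 ≤ 1)
  (h155 : (2 * (L : ℝ) - 1) * (L : ℝ)⁻¹ ^ 2 + 2 * d * thetaGen d L α₀ * (L : ℝ)⁻¹ ^ 3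
    + 1 / 8 * (1 + 2 * d * thetaGen d L α₀ * (L : ℝ)⁻¹ ^ 2 + 2 * d * C3Gen d L * ((L : ℝ) ^ k * b)) * (L : ℝ)⁻¹ ^ 2 ≤ 1)
  (S : Finset (B7Prop1Explicit.Site d × Fin d))
  (lv : Finset ℕ) (T : ℕ → Finset (B7Prop1Explicit.Site d × Fin d)) (w : ℕ → B7Prop1Explicit.Site d × Fin d → ℝ) (K : ℕ → B7Prop1Explicit.Site d × Fin d → 𝔸)

/-- **The level-`j` piece of `⟨C⁽²⁾(A), H*J⟩`** (before the trace): `F_j(a) = Σ_{c∈T_j} w_j(c)·C_j⁽²⁾(U₀, ins_S a)(c)·K_j(c)` —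
p06's `secondForm` of `B9Ineq3137From149` §3 («Σ_{b∈Λ_j}(Lʲη)^{d+1} C_j⁽²⁾(A,b)(H*J)(b)»: `T_j` = «Λ_j», `w_j` = «(Lʲη)^{d+1}»,
`K_j` = «(H*J)(b)»), with [5]'s CONCRETE second-order term `B7Eq136SecondOrder.CCovIter2`.
[cite: Balaban1985BackgroundPropagators, (3.134) p.422, (3.136) p.422] [cite: Balaban1985Averaging, (136) p.39] -/
def levelForm (j : ℕ) (a : S → 𝔸) : 𝔸 :=
  ∑ c ∈ T j, (w j c : ℂ) • (CCovIter2 L U₀ (insCfg S a) j c.1 c.2 * K j c)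

/-- **`⟨C⁽²⁾(A), H*J⟩` before the trace, the printed LEVEL SUM**: `F(a) = Σ_{j∈lv} F_j(a)` — «Σ_{j=1}^{k} Σ_{b∈Λ_j} …» of (3.136),
the quadratic form whose real-coordinate matrix is p10's `𝒞`. [cite: Balaban1985BackgroundPropagators, (3.134) p.422, (3.136) p.422] -/
def secondFormSum (a : S → 𝔸) : 𝔸 := ∑ j ∈ lv, levelForm L U₀ S T w K j a

/-- the polarization `D²[C_j(U₀, ins_S ·)(c)](0)` of [5]'s remainder at level `j`, coarse bond `c` ([B11] (56) «symmetric bilinear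
form obtained by polarization»; `B7Eq136SecondOrder` §2). [cite: Balaban1985Averaging, (136)–(137) p.39]
[cite: Balaban1985BackgroundPropagators, (3.136) p.422] -/
def D2 (j : ℕ) (c : B7Prop1Explicit.Site d × Fin d) : (S → 𝔸) →L[ℂ] (S → 𝔸) →L[ℂ] 𝔸 :=
  fderiv ℂ (fderiv ℂ (fun a' : S → 𝔸 => CCovIter L U₀ (insCfg S a') j c.1 c.2)) 0

/-- the polarization of the level-`j` piece as ONE continuous bilinear map: `B_j(a)(a′) = Σ_c w_j(c)·D²f_{jc}(0)(a)(a′)·K_j(c)`.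
[cite: Balaban1985BackgroundPropagators, (3.136) p.422] -/
def polarLevel (j : ℕ) : (S → 𝔸) →L[ℂ] (S → 𝔸) →L[ℂ] 𝔸 :=
  ∑ c ∈ T j, (w j c : ℂ) •
    ((ContinuousLinearMap.compL ℂ (S → 𝔸) 𝔸 𝔸 ((ContinuousLinearMap.mul ℂ 𝔸).flip (K j c))).comp (D2 L U₀ S j c))

/-- the polarization of the level sum: `B = Σ_{j∈lv} B_j`. [cite: Balaban1985BackgroundPropagators, (3.136) p.422] -/
def polarSum : (S → 𝔸) →L[ℂ] (S → 𝔸) →L[ℂ] 𝔸 := ∑ j ∈ lv, polarLevel L U₀ S T w K j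

omit [NormOneClass 𝔸] in
/-- `B_j(a)(a′)` evaluated. [cite: Balaban1985BackgroundPropagators, (3.136) p.422] -/
theorem polarLevel_apply (j : ℕ) (a a' : S → 𝔸) :
    polarLevel L U₀ S T w K j a a' = ∑ c ∈ T j, (w j c : ℂ) • (D2 L U₀ S j c a a' * K j c) := by
  simp only [polarLevel, _root_.sum_apply, _root_.smul_apply, ContinuousLinearMap.comp_apply,
    ContinuousLinearMap.compL_apply, ContinuousLinearMap.flip_apply, ContinuousLinearMap.mul_apply']

omit [NormOneClass 𝔸] in
/-- `B(a)(a′)` evaluated. [cite: Balaban1985BackgroundPropagators, (3.136) p.422] -/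
theorem polarSum_apply (a a' : S → 𝔸) :
    polarSum L U₀ S lv T w K a a' = ∑ j ∈ lv, polarLevel L U₀ S T w K j a a' := by
  simp only [polarSum, _root_.sum_apply]

include hL hG hU₀ hα hα3 hα4 h52 hb hsmall hc₃ in
/-- **`F_j(a) = ½B_j(a)(a)`** — each `C_j⁽²⁾(U₀, ins_S a)(c)` is the diagonal of its polarization
(`B7Eq136SecondOrder.CCovIter2_ins_eq`). [cite: Balaban1985BackgroundPropagators, (3.134) p.422] [cite: Balaban1985Averaging, (136) p.39] -/
theorem levelForm_eq_half_polar {j : ℕ} (hj : j ≤ k) (a : S → 𝔸) :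
    levelForm L U₀ S T w K j a = (2 : ℂ)⁻¹ • polarLevel L U₀ S T w K j a a := by
  rw [polarLevel_apply, levelForm, Finset.smul_sum]
  refine Finset.sum_congr rfl fun c _ => ?_
  rw [CCovIter2_ins_eq L hL hG k U₀ hU₀ hα hα3 hα4 h52 hb hsmall hc₃ S hj c.1 c.2 a, D2, smul_mul_assoc, smul_comm]

include hL hG hU₀ hα hα3 hα4 h52 hb hsmall hc₃ in
/-- **`F(a) = ½B(a)(a)`**: the level sum is the quadratic form of its polarization.
[cite: Balaban1985BackgroundPropagators, (3.134) p.422] -/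
theorem secondFormSum_eq_half_polar (hJ : ∀ j ∈ lv, j ≤ k) (a : S → 𝔸) :
    secondFormSum L U₀ S lv T w K a = (2 : ℂ)⁻¹ • polarSum L U₀ S lv T w K a a := by
  rw [polarSum_apply, secondFormSum, Finset.smul_sum]
  exact Finset.sum_congr rfl fun j hj => levelForm_eq_half_polar L hL hG k U₀ hU₀ hα hα3 hα4 h52 hb hsmall hc₃ S T w K (hJ j hj) a

include hL hG hU₀ hα hα3 hα4 h52 hb hsmall hc₃ in
/-- **the polarization is symmetric** (`B7Eq136SecondOrder.snd_fderiv_CCovIter_ins_symm`, [B11] (56)).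
[cite: Balaban1985BackgroundPropagators, (3.134) p.422] [cite: Balaban1985Variational, (56) p.286] -/
theorem polarSum_symm (hJ : ∀ j ∈ lv, j ≤ k) (a a' : S → 𝔸) :
    polarSum L U₀ S lv T w K a a' = polarSum L U₀ S lv T w K a' a := by
  rw [polarSum_apply, polarSum_apply]
  refine Finset.sum_congr rfl fun j hj => ?_
  rw [polarLevel_apply, polarLevel_apply]
  refine Finset.sum_congr rfl fun c _ => ?_
  rw [D2, snd_fderiv_CCovIter_ins_symm L hL hG k U₀ hU₀ hα hα3 hα4 h52 hb hsmall hc₃ S (hJ j hj) c.1 c.2 a a']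

include hL hG hU₀ hα hα3 hα4 h52 hb hsmall hc₃ in
/-- **(3.136) at level `j`**: `DF_j(a) = B_j(a)` — p06's `hasFDerivAt_secondForm` with the derivative named as the polarization
(`B7Eq136SecondOrder.hasFDerivAt_CCovIter2_ins`). [cite: Balaban1985BackgroundPropagators, (3.136) p.422] -/
theorem hasFDerivAt_levelForm {j : ℕ} (hj : j ≤ k) (a : S → 𝔸) :
    HasFDerivAt (levelForm L U₀ S T w K j) (polarLevel L U₀ S T w K j a) a := by
  have h : HasFDerivAt (levelForm L U₀ S T w K j)
      (∑ c ∈ T j, (w j c : ℂ) • ((D2 L U₀ S j c a).smulRight (K j c))) a := by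
    show HasFDerivAt (fun a' : S → 𝔸 => ∑ c ∈ T j, (w j c : ℂ) • (CCovIter2 L U₀ (insCfg S a') j c.1 c.2 * K j c)) _ a
    refine HasFDerivAt.fun_sum fun c _ => ?_
    exact ((hasFDerivAt_CCovIter2_ins L hL hG k U₀ hU₀ hα hα3 hα4 h52 hb hsmall hc₃ S hj c.1 c.2 a).mul_const'
      (K j c)).const_smul (w j c : ℂ)
  refine h.congr_fderiv (ContinuousLinearMap.ext fun δa => ?_)
  rw [polarLevel_apply, _root_.sum_apply]
  refine Finset.sum_congr rfl fun c _ => ?_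
  rw [_root_.smul_apply, ContinuousLinearMap.smulRight_apply, smul_eq_mul]

include hL hG hU₀ hα hα3 hα4 h52 hb hsmall hc₃ in
/-- **(3.136) for the level sum**: `DF(a) = B(a)`. [cite: Balaban1985BackgroundPropagators, (3.136) p.422] -/
theorem hasFDerivAt_secondFormSum (hJ : ∀ j ∈ lv, j ≤ k) (a : S → 𝔸) :
    HasFDerivAt (secondFormSum L U₀ S lv T w K) (polarSum L U₀ S lv T w K a) a := by
  have h := HasFDerivAt.fun_sum (u := lv) fun j hj =>
    hasFDerivAt_levelForm L hL hG k U₀ hU₀ hα hα3 hα4 h52 hb hsmall hc₃ S T w K (hJ j hj) a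
  refine (h.congr_fderiv ?_)
  rw [polarSum, _root_.sum_apply]

include hL hG hU₀ hα hα3 hα4 h52 hb hsmall hc₃ in
/-- `fderiv` form. [cite: Balaban1985BackgroundPropagators, (3.136) p.422] -/
theorem fderiv_secondFormSum (hJ : ∀ j ∈ lv, j ≤ k) (a : S → 𝔸) :
    fderiv ℂ (secondFormSum L U₀ S lv T w K) a = polarSum L U₀ S lv T w K a :=
  (hasFDerivAt_secondFormSum L hL hG k U₀ hU₀ hα hα3 hα4 h52 hb hsmall hc₃ S lv T w K hJ a).fderiv

/-! ## §3 THE MATRIX `𝒞` of `A ↦ ⟨HC⁽²⁾(A),J⟩` in real coordinates, and (3.134)/(3.136) for p10's `Δ⁽²⁾ = 𝒞 + 𝒞ᵀ` -/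

variable {ι : Type*} (e : ι → 𝔸) (τ : 𝔸 →L[ℝ] ℝ)

/-- **coordinate directions** `e_{(s,i)}` = the configuration on the fine bonds `S` with value `e_i` at `s` and `0` elsewhere
(`e : ι → 𝔸` a finite family, e.g. a real basis of `𝔤 ⊂ 𝔸`; real coordinates `x : S × ι → ℝ`, `A(x)(s) = Σ_i x(s,i)e_i`).
[cite: Balaban1985BackgroundPropagators, (3.134) p.422] -/
def dir (e : ι → 𝔸) : S × ι → (S → 𝔸) := fun p => Pi.single p.1 (e p.2)

omit [NormedAlgebra ℂ 𝔸] [CompleteSpace 𝔸] [NormOneClass 𝔸] in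
/-- `e_{(s,i)}` unfolded. [cite: Balaban1985BackgroundPropagators, (3.134) p.422] -/
theorem dir_apply (p : S × ι) : dir S e p = Pi.single p.1 (e p.2) := rfl

omit [CompleteSpace 𝔸] [NormOneClass 𝔸] in
/-- **`A(x)(s) = Σ_i x(s,i)·e_i`**: the configuration with real coordinates `x`. [cite: Balaban1985BackgroundPropagators, (3.134) p.422] -/
theorem coord_dir_apply [Fintype ι] (x : S × ι → ℝ) (s : S) : coord (dir S e) x s = ∑ i, (x (s, i) : ℂ) • e i := by
  classical
  simp only [coord, dir, Finset.sum_apply, Pi.smul_apply, Fintype.sum_prod_type]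
  rw [Finset.sum_eq_single s]
  · simp
  · intro s' _ hs'
    simp [Pi.single_eq_of_ne (Ne.symm hs')]
  · intro hs
    exact absurd (Finset.mem_univ s) hs

/-- **THE MATRIX `𝒞`** — p10's *"`𝒞 : Matrix b b ℝ` is the matrix of the quadratic form `A ↦ ⟨HC⁽²⁾(A),J⟩`"* (`B9Eq3152` note (b),
`B9Delta2Def134` §1) REALISED from [5]'s concrete `C_j⁽²⁾`: in the real coordinates `x : S × ι → ℝ` of `A(x) = Σ x(s,i)e_{(s,i)}`,
`𝒞_{pq} = ½·τ(B(e_p, e_q))` with `B` the polarization of `F = Σ_jΣ_c w_j(c)·C_j⁽²⁾(U₀, ins_S ·)(c)·K_j(c)` and `τ` the trace functional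
(«tr» and the pairing weights), so that `x ⬝ᵥ 𝒞x = τ(F(A(x)))` (`dotProduct_calC_mulVec`).
[cite: Balaban1985BackgroundPropagators, (3.134) p.422, (3.136) p.422] [cite: Balaban1985Averaging, (136) p.39] -/
def calC : Matrix (S × ι) (S × ι) ℝ := realMatrix τ (dir S e) (polarSum L U₀ S lv T w K)

omit [NormOneClass 𝔸] in
/-- `𝒞_{pq}` unfolded down to [5]'s polarizations: `𝒞_{(s,i),(s′,i′)} = ½τ(Σ_jΣ_c w_j(c)·D²f_{jc}(0)(e_{(s,i)})(e_{(s′,i′)})·K_j(c))`.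
[cite: Balaban1985BackgroundPropagators, (3.134) p.422, (3.136) p.422] -/
theorem calC_apply (p q : S × ι) :
    calC L U₀ S lv T w K e τ p q = (1 / 2 : ℝ) * τ (∑ j ∈ lv, ∑ c ∈ T j,
      (w j c : ℂ) • (D2 L U₀ S j c (Pi.single p.1 (e p.2)) (Pi.single q.1 (e q.2)) * K j c)) := by
  rw [calC, realMatrix_apply, polarSum_apply]
  simp only [polarLevel_apply, dir]

include hL hG hU₀ hα hα3 hα4 h52 hb hsmall hc₃ in
/-- **«`𝒞` is the matrix of the quadratic form `A ↦ ⟨HC⁽²⁾(A),J⟩`» REALISED**: `x ⬝ᵥ 𝒞x = τ(F(A(x)))` with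
`F = Σ_{j}Σ_{c∈T_j} w_j(c)·C_j⁽²⁾(U₀, ins_S A(x))(c)·K_j(c)` — the identification p10's file took as the MEANING of `𝒞`, now a theorem
for [5]'s concrete `C_j⁽²⁾`. [cite: Balaban1985BackgroundPropagators, (3.134) p.422, (3.136) p.422] [cite: Balaban1985Averaging, (136) p.39] -/
theorem dotProduct_calC_mulVec [Fintype ι] (hJ : ∀ j ∈ lv, j ≤ k) (x : S × ι → ℝ) :
    x ⬝ᵥ calC L U₀ S lv T w K e τ *ᵥ x = τ (secondFormSum L U₀ S lv T w K (coord (dir S e) x)) := by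
  rw [calC, dotProduct_realMatrix_mulVec,
    secondFormSum_eq_half_polar L hL hG k U₀ hU₀ hα hα3 hα4 h52 hb hsmall hc₃ S lv T w K hJ,
    show (2 : ℂ)⁻¹ = ((1 / 2 : ℝ) : ℂ) by push_cast; ring, Complex.coe_smul, map_smul, smul_eq_mul]

include hL hG hU₀ hα hα3 hα4 h52 hb hsmall hc₃ in
/-- **(3.134) FOR THE CONCRETE `Δ⁽²⁾`**: with p10's `Δ⁽²⁾ := 𝒞 + 𝒞ᵀ` (`B9Delta2Def134.delta2`),
`⟨A, Δ⁽²⁾A⟩ = 2⟨HC⁽²⁾(A),J⟩`, i.e. `x ⬝ᵥ Δ⁽²⁾x = 2·τ(F(A(x)))`. [cite: Balaban1985BackgroundPropagators, (3.134) p.422] -/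
theorem eq3134_concrete [Fintype ι] (hJ : ∀ j ∈ lv, j ≤ k) (x : S × ι → ℝ) :
    x ⬝ᵥ B9Delta2Def134.delta2 (calC L U₀ S lv T w K e τ) *ᵥ x =
      2 * τ (secondFormSum L U₀ S lv T w K (coord (dir S e) x)) := by
  rw [B9Delta2Def134.eq_3134, dotProduct_calC_mulVec L hL hG k U₀ hU₀ hα hα3 hα4 h52 hb hsmall hc₃ S lv T w K e τ hJ]

include hL hG hU₀ hα hα3 hα4 h52 hb hsmall hc₃ in
/-- `𝒞` is symmetric (the polarization is). [cite: Balaban1985BackgroundPropagators, (3.134) p.422] -/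
theorem calC_transpose (hJ : ∀ j ∈ lv, j ≤ k) :
    (calC L U₀ S lv T w K e τ)ᵀ = calC L U₀ S lv T w K e τ :=
  realMatrix_transpose τ (dir S e) _ (polarSum_symm L hL hG k U₀ hU₀ hα hα3 hα4 h52 hb hsmall hc₃ S lv T w K hJ)

include hL hG hU₀ hα hα3 hα4 h52 hb hsmall hc₃ in
/-- hence `Δ⁽²⁾ = 2𝒞` (p10's `delta2_of_symm`). [cite: Balaban1985BackgroundPropagators, (3.134) p.422] -/
theorem delta2_calC (hJ : ∀ j ∈ lv, j ≤ k) :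
    B9Delta2Def134.delta2 (calC L U₀ S lv T w K e τ) = (2 : ℝ) • calC L U₀ S lv T w K e τ :=
  B9Delta2Def134.delta2_of_symm _ (calC_transpose L hL hG k U₀ hU₀ hα hα3 hα4 h52 hb hsmall hc₃ S lv T w K e τ hJ)

include hL hG hU₀ hα hα3 hα4 h52 hb hsmall hc₃ in
/-- **(3.136) FOR THE CONCRETE `Δ⁽²⁾`**: `(Δ⁽²⁾x)_{(s,i)} = τ(DF(A(x)) e_{(s,i)})` — p10's `Δ⁽²⁾A` (a matrix–vector product on the
Sect.-D carrier) IS the real-coordinate gradient «Σ_jΣ_{b∈Λ_j}(Lʲη)^{d+1} tr (δ/δA)C_j⁽²⁾(A,b)(H*J)(b)» of p06's concrete form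
(`hasFDerivAt_secondFormSum`). [cite: Balaban1985BackgroundPropagators, (3.136) p.422] -/
theorem eq3136_concrete [Fintype ι] (hJ : ∀ j ∈ lv, j ≤ k) (x : S × ι → ℝ) (p : S × ι) :
    (B9Delta2Def134.delta2 (calC L U₀ S lv T w K e τ) *ᵥ x) p =
      τ (fderiv ℂ (secondFormSum L U₀ S lv T w K) (coord (dir S e) x) (dir S e p)) := by
  rw [calC, delta2_realMatrix_mulVec_apply_of_symm τ (dir S e) _
      (polarSum_symm L hL hG k U₀ hU₀ hα hα3 hα4 h52 hb hsmall hc₃ S lv T w K hJ),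
    fderiv_secondFormSum L hL hG k U₀ hU₀ hα hα3 hα4 h52 hb hsmall hc₃ S lv T w K hJ]

include hL hG hU₀ hα hα3 hα4 h52 hb hsmall hc₃ in
/-- **the pairing `⟨δA, Δ⁽²⁾A⟩ = τ(DF(A)δA)` FOR THE CONCRETE `Δ⁽²⁾`** — the left-hand side of the display after (3.136), now an
identity between p10's matrix pairing and the derivative of p06's form. [cite: Balaban1985BackgroundPropagators, (3.136) p.422, (3.137) p.423] -/
theorem eq3136_concrete_pairing [Fintype ι] (hJ : ∀ j ∈ lv, j ≤ k) (x δx : S × ι → ℝ) :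
    δx ⬝ᵥ B9Delta2Def134.delta2 (calC L U₀ S lv T w K e τ) *ᵥ x =
      τ (fderiv ℂ (secondFormSum L U₀ S lv T w K) (coord (dir S e) x) (coord (dir S e) δx)) := by
  rw [calC, dotProduct_delta2_realMatrix_mulVec τ (dir S e) _
      (polarSum_symm L hL hG k U₀ hU₀ hα hα3 hα4 h52 hb hsmall hc₃ S lv T w K hJ),
    fderiv_secondFormSum L hL hG k U₀ hU₀ hα hα3 hα4 h52 hb hsmall hc₃ S lv T w K hJ]

include hL hG hU₀ hα hα3 hα4 h52 hb hsmall hc₃ in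
/-- **«it defines»** (p10's `delta2_unique`) FOR THE CONCRETE FORM: any symmetric real matrix whose quadratic form is
`2τ(F(A(x)))` IS `Δ⁽²⁾ = 𝒞 + 𝒞ᵀ`. [cite: Balaban1985BackgroundPropagators, (3.134) p.422] -/
theorem delta2_calC_unique [Fintype ι] [DecidableEq ι] (hJ : ∀ j ∈ lv, j ≤ k) (M : Matrix (S × ι) (S × ι) ℝ) (hM : Mᵀ = M)
    (h : ∀ x : S × ι → ℝ, x ⬝ᵥ M *ᵥ x = 2 * τ (secondFormSum L U₀ S lv T w K (coord (dir S e) x))) :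
    M = B9Delta2Def134.delta2 (calC L U₀ S lv T w K e τ) := by
  classical
  refine B9Delta2Def134.delta2_unique _ M hM fun x => ?_
  rw [h x, dotProduct_calC_mulVec L hL hG k U₀ hU₀ hα hα3 hα4 h52 hb hsmall hc₃ S lv T w K e τ hJ]

/-! ## §4 THE (149)-DISPLAY AND (3.137) FOR THE CONCRETE `Δ⁽²⁾` — p10's hypothesis `h149` of `ineq3137b_of_149`
DISCHARGED on the realised matrix, from p06's per-level bounds -/

omit [NormedAlgebra ℂ 𝔸] [CompleteSpace 𝔸] [NormOneClass 𝔸] in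
/-- `C₃ ≥ 0`. [cite: Balaban1985Averaging, (149) p.40] -/
theorem C3Gen_nonneg (d L : ℕ) : 0 ≤ C3Gen d L := by
  unfold C3Gen C1ppGen; positivity

omit [CompleteSpace 𝔸] [NormOneClass 𝔸] in
/-- `‖A(x)(s)‖ ≤ Σ_i ‖e_i‖·|x(s,i)|`. [cite: Balaban1985BackgroundPropagators, (3.137) p.423] -/
theorem norm_coord_dir_apply_le [Fintype ι] (x : S × ι → ℝ) (s : S) :
    ‖coord (dir S e) x s‖ ≤ ∑ i, ‖e i‖ * |x (s, i)| := by
  rw [coord_dir_apply]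
  refine norm_sum_le_of_le _ fun i _ => ?_
  rw [norm_smul, Complex.norm_real, Real.norm_eq_abs, mul_comm]

omit [NormedRing 𝔸] [NormedAlgebra ℂ 𝔸] [CompleteSpace 𝔸] [NormOneClass 𝔸] in
/-- bookkeeping: `Σ_j C_j Σ_c Y_{jc} Σ_s k_{jcs} N_s = Σ_s (Σ_j C_j Σ_c Y_{jc} k_{jcs}) N_s`. [cite: Balaban1985BackgroundPropagators, (3.137) p.423] -/
theorem sum_rearrange {β σ : Type*} [Fintype σ] (lv : Finset ℕ) (T : ℕ → Finset β) (C : ℕ → ℝ) (Y : ℕ → β → ℝ)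
    (kk : ℕ → β → σ → ℝ) (N : σ → ℝ) :
    ∑ j ∈ lv, C j * ∑ c ∈ T j, Y j c * ∑ s, kk j c s * N s =
      ∑ s, (∑ j ∈ lv, C j * ∑ c ∈ T j, Y j c * kk j c s) * N s := by
  simp only [Finset.mul_sum, Finset.sum_mul]
  rw [Finset.sum_comm]
  refine Finset.sum_congr rfl fun j _ => ?_
  rw [Finset.sum_comm]
  exact Finset.sum_congr rfl fun c _ => Finset.sum_congr rfl fun s _ => by ring

include hL hG hU₀ hα hα3 hα4 h52 hb hsmall hc₃ h145 h155 in
/-- p06's display at level `j`, restated for `levelForm`: `‖DF_j(a)δa‖ ≤ C₃(Lʲ)²‖a‖·Σ_c w_j(c)‖K_j(c)‖·Σ_s kerQdd_j(c,s)‖δa_s‖`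
(`B9Ineq3137From149.norm_fderiv_secondForm_le`). [cite: Balaban1985BackgroundPropagators, (3.136) p.422, (3.137) p.423]
[cite: Balaban1985Averaging, (149) p.40] -/
theorem norm_fderiv_levelForm_le {j : ℕ} (hw : ∀ c ∈ T j, 0 ≤ w j c) (hj : j ≤ k) (a δa : S → 𝔸) :
    ‖fderiv ℂ (levelForm L U₀ S T w K j) a δa‖ ≤
      C3Gen d L * ((L : ℝ) ^ j) ^ 2 * ‖a‖ *
        ∑ c ∈ T j, w j c * ‖K j c‖ * ∑ s : S, kerQdd L j c.1 c.2 s.1.1 s.1.2 * ‖δa s‖ :=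
  norm_fderiv_secondForm_le L hL hG k U₀ hU₀ hα hα3 hα4 h52 hb hsmall hc₃ h145 h155 S (T j) (w j) (K j) hw hj a δa

include hL hG hU₀ hα hα3 hα4 h52 hb hsmall hc₃ h145 h155 in
/-- **the display for the LEVEL SUM**: `‖DF(a)δa‖ ≤ Σ_{j} C₃(Lʲ)²‖a‖·Σ_{c∈T_j} w_j(c)‖K_j(c)‖·Σ_s kerQdd_j(c,s)‖δa_s‖` — «Σ_{j}Σ_{b∈Λ_j}
(Lʲη)^{d−2}(Q″_j|δA|)(b)|A|_b» once `w_j‖K_j‖ ≦ (Lʲη)^{d+1}·O(1)Mα₀(Lʲη)⁻³` is inserted (p06's dictionary).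
[cite: Balaban1985BackgroundPropagators, (3.136) p.422, (3.137) p.423] [cite: Balaban1985Averaging, (149) p.40] -/
theorem norm_fderiv_secondFormSum_le (hw : ∀ j ∈ lv, ∀ c ∈ T j, 0 ≤ w j c) (hJ : ∀ j ∈ lv, j ≤ k) (a δa : S → 𝔸) :
    ‖fderiv ℂ (secondFormSum L U₀ S lv T w K) a δa‖ ≤
      ∑ j ∈ lv, C3Gen d L * ((L : ℝ) ^ j) ^ 2 * ‖a‖ *
        ∑ c ∈ T j, w j c * ‖K j c‖ * ∑ s : S, kerQdd L j c.1 c.2 s.1.1 s.1.2 * ‖δa s‖ := by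
  rw [fderiv_secondFormSum L hL hG k U₀ hU₀ hα hα3 hα4 h52 hb hsmall hc₃ S lv T w K hJ, polarSum_apply]
  refine norm_sum_le_of_le _ fun j hj => ?_
  rw [← (hasFDerivAt_levelForm L hL hG k U₀ hU₀ hα hα3 hα4 h52 hb hsmall hc₃ S T w K (hJ j hj) a).fderiv]
  exact norm_fderiv_levelForm_le L hL hG k U₀ hU₀ hα hα3 hα4 h52 hb hsmall hc₃ h145 h155 S T w K (hw j hj) (hJ j hj) a δa

include hL hG hU₀ hα hα3 hα4 h52 hb hsmall hc₃ h145 h155 in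
/-- **«The inequality (149) in [5] implies |⟨δA, Δ⁽²⁾A⟩| ≦ …» FOR THE CONCRETE `Δ⁽²⁾`** (p10's matrix pairing on the left):
`|δx ⬝ᵥ Δ⁽²⁾x| ≤ ‖τ‖·Σ_j C₃(Lʲ)²‖A(x)‖·Σ_{c∈T_j} w_j(c)‖K_j(c)‖·Σ_s kerQdd_j(c,s)‖A(δx)_s‖`.
[cite: Balaban1985BackgroundPropagators, (3.136) p.422, (3.137) p.423] [cite: Balaban1985Averaging, (149) p.40] -/
theorem abs_eq3136_pairing_le [Fintype ι] (hw : ∀ j ∈ lv, ∀ c ∈ T j, 0 ≤ w j c) (hJ : ∀ j ∈ lv, j ≤ k)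
    (x δx : S × ι → ℝ) :
    |δx ⬝ᵥ B9Delta2Def134.delta2 (calC L U₀ S lv T w K e τ) *ᵥ x| ≤
      ‖τ‖ * ∑ j ∈ lv, C3Gen d L * ((L : ℝ) ^ j) ^ 2 * ‖coord (dir S e) x‖ *
        ∑ c ∈ T j, w j c * ‖K j c‖ * ∑ s : S, kerQdd L j c.1 c.2 s.1.1 s.1.2 * ‖coord (dir S e) δx s‖ := by
  rw [eq3136_concrete_pairing L hL hG k U₀ hU₀ hα hα3 hα4 h52 hb hsmall hc₃ S lv T w K e τ hJ, ← Real.norm_eq_abs]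
  exact (τ.le_opNorm _).trans (mul_le_mul_of_nonneg_left
    (norm_fderiv_secondFormSum_le L hL hG k U₀ hU₀ hα hα3 hα4 h52 hb hsmall hc₃ h145 h155 S lv T w K hw hJ _ _)
    (norm_nonneg _))

include hL hG hU₀ hα hα3 hα4 h52 hb hsmall hc₃ h145 h155 in
/-- **p10's HYPOTHESIS `h149` OF `B9Delta2Def134.ineq3137b_of_149` DISCHARGED FOR THE CONCRETE `Δ⁽²⁾`** — the display in the
shape `|⟨δA, Δ⁽²⁾A⟩| ≤ Σ_{(s,i)} Γ_{(s,i)}·|δA(s,i)|` with the EXPLICIT coefficient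
`Γ_{(s,i)} = ‖τ‖‖e_i‖·Σ_j C₃(Lʲ)²‖A(x)‖·Σ_{c∈T_j} w_j(c)‖K_j(c)‖·kerQdd_j(c,s)` («O(1)C₃Mα₀ΣΣ(Lʲη)^{d−2}(Q″_j|δA|)(c)|A|_c» read
per fine bond). [cite: Balaban1985BackgroundPropagators, (3.137) p.423] [cite: Balaban1985Averaging, (141) p.39, (149) p.40] -/
theorem h149_concrete [Fintype ι] (hw : ∀ j ∈ lv, ∀ c ∈ T j, 0 ≤ w j c) (hJ : ∀ j ∈ lv, j ≤ k) (x δx : S × ι → ℝ) :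
    |δx ⬝ᵥ B9Delta2Def134.delta2 (calC L U₀ S lv T w K e τ) *ᵥ x| ≤
      ∑ p : S × ι, (‖τ‖ * ‖e p.2‖ * ∑ j ∈ lv, C3Gen d L * ((L : ℝ) ^ j) ^ 2 * ‖coord (dir S e) x‖ *
        ∑ c ∈ T j, w j c * ‖K j c‖ * kerQdd L j c.1 c.2 p.1.1.1 p.1.1.2) * |δx p| := by
  have h := abs_eq3136_pairing_le L hL hG k U₀ hU₀ hα hα3 hα4 h52 hb hsmall hc₃ h145 h155 S lv T w K e τ hw hJ x δx
  refine h.trans ?_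
  -- replace `‖A(δx)_s‖` by `Σ_i ‖e_i‖|δx(s,i)|`
  have hmono : ∑ j ∈ lv, C3Gen d L * ((L : ℝ) ^ j) ^ 2 * ‖coord (dir S e) x‖ *
        ∑ c ∈ T j, w j c * ‖K j c‖ * ∑ s : S, kerQdd L j c.1 c.2 s.1.1 s.1.2 * ‖coord (dir S e) δx s‖ ≤
      ∑ j ∈ lv, C3Gen d L * ((L : ℝ) ^ j) ^ 2 * ‖coord (dir S e) x‖ *
        ∑ c ∈ T j, w j c * ‖K j c‖ * ∑ s : S, kerQdd L j c.1 c.2 s.1.1 s.1.2 * ∑ i, ‖e i‖ * |δx (s, i)| := by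
    refine Finset.sum_le_sum fun j hj => mul_le_mul_of_nonneg_left ?_ (by positivity [C3Gen_nonneg d L])
    refine Finset.sum_le_sum fun c hc => mul_le_mul_of_nonneg_left ?_ (mul_nonneg (hw j hj c hc) (norm_nonneg _))
    exact Finset.sum_le_sum fun s _ => mul_le_mul_of_nonneg_left (norm_coord_dir_apply_le S e δx s)
      (kerQdd_nonneg L j _ _ _ _)
  refine (mul_le_mul_of_nonneg_left hmono (norm_nonneg _)).trans (le_of_eq ?_)
  -- rearrange the finite sums
  rw [sum_rearrange, Finset.mul_sum, Fintype.sum_prod_type]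
  refine Finset.sum_congr rfl fun s _ => ?_
  rw [mul_left_comm, Finset.mul_sum, Finset.mul_sum]
  refine Finset.sum_congr rfl fun i _ => ?_
  dsimp only
  ring

include hL hG hU₀ hα hα3 hα4 h52 hb hsmall hc₃ h145 h155 in
/-- **(3.137) FOR THE CONCRETE `Δ⁽²⁾`, level sum**: with the `(H*J)`-budget `w_j(c)‖K_j(c)‖ ≤ κ_j` on `T_j`
(«(Lʲη)^{d+1}·O(1)Mα₀(Lʲη)⁻³», row B9.Eq3.134's first half / `B9Ineq3137Regular`),
`|(Δ⁽²⁾x)_{(s,i)}| ≤ ‖τ‖·(Σ_j 2d·κ_j·C₃(Lʲ)²·L^{−jd})·‖A(x)‖·‖e_i‖` — each level contributes p06's hence-step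
`norm_fderiv_secondForm_single_le` (the count dual to [5] (141)/(142)). [cite: Balaban1985BackgroundPropagators, (3.137) p.423]
[cite: Balaban1985Averaging, (141)–(142) p.39, (149) p.40] -/
theorem abs_eq3136_apply_le [Fintype ι] (hw : ∀ j ∈ lv, ∀ c ∈ T j, 0 ≤ w j c) (κ : ℕ → ℝ) (hκ : ∀ j ∈ lv, 0 ≤ κ j)
    (hK : ∀ j ∈ lv, ∀ c ∈ T j, w j c * ‖K j c‖ ≤ κ j) (hJ : ∀ j ∈ lv, j ≤ k) (x : S × ι → ℝ) (p : S × ι) :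
    |(B9Delta2Def134.delta2 (calC L U₀ S lv T w K e τ) *ᵥ x) p| ≤
      ‖τ‖ * ((∑ j ∈ lv, 2 * d * κ j * (C3Gen d L * ((L : ℝ) ^ j) ^ 2 * (((L : ℝ) ^ j) ^ d)⁻¹)) *
        ‖coord (dir S e) x‖ * ‖e p.2‖) := by
  classical
  rw [eq3136_concrete L hL hG k U₀ hU₀ hα hα3 hα4 h52 hb hsmall hc₃ S lv T w K e τ hJ, ← Real.norm_eq_abs]
  refine (τ.le_opNorm _).trans (mul_le_mul_of_nonneg_left ?_ (norm_nonneg _))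
  rw [fderiv_secondFormSum L hL hG k U₀ hU₀ hα hα3 hα4 h52 hb hsmall hc₃ S lv T w K hJ, polarSum_apply, dir_apply,
    Finset.sum_mul, Finset.sum_mul]
  refine norm_sum_le_of_le _ fun j hj => ?_
  rw [← (hasFDerivAt_levelForm L hL hG k U₀ hU₀ hα hα3 hα4 h52 hb hsmall hc₃ S T w K (hJ j hj) _).fderiv]
  exact norm_fderiv_secondForm_single_le L hL hG k U₀ hU₀ hα hα3 hα4 h52 hb hsmall hc₃ h145 h155 S (T j) (w j) (K j)
    (hw j hj) (hκ j hj) (hK j hj) (hJ j hj) _ p.1 (e p.2)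

include hL hG hU₀ hα hα3 hα4 h52 hb hsmall hc₃ h145 h155 in
/-- **(3.137) AS p10's `Ineq3137b` FOR THE CONCRETE MATRIX, ONE LEVEL** (`lv = {j}`, «b ∈ Δ(y), y ∈ Λ_j»): with the printed
`(H*J)`-budget `w_j(c)·‖K_j(c)‖ ≤ c₀·M·α₀·(Lʲ)^{d−2}` («(Lʲη)^{d+1}·O(1)Mα₀(Lʲη)⁻³», tree units `Lʲη ↦ Lʲ`) and `‖e_i‖ ≤ M_e`,
`|(Δ⁽²⁾x)(b)| ≤ c·M·α₀·(Lʲ)⁻²·|A|` with `c = 2d·C₃·‖τ‖·M_e·c₀` and `|A| ↦ (Lʲ)²‖A(x)‖` (p06's DICTIONARY of `B9Ineq3137From149`: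
«`|A|·` ↦ `(Lʲ)²‖a‖`»; `(Lʲ)^{d−2}·(Lʲ)²·L^{−jd} = 1`). [cite: Balaban1985BackgroundPropagators, (3.137) p.423]
[cite: Balaban1985Averaging, (141)–(142) p.39, (149) p.40] -/
theorem ineq3137b_concrete [Fintype ι] (hd : 2 ≤ d) {j : ℕ} (hj : j ≤ k) (hw : ∀ c ∈ T j, 0 ≤ w j c)
    {c₀ M Me : ℝ} (hc₀ : 0 ≤ c₀ * M) (he : ∀ i, ‖e i‖ ≤ Me)
    (hK : ∀ c ∈ T j, w j c * ‖K j c‖ ≤ c₀ * M * α₀ * ((L : ℝ) ^ j) ^ (d - 2)) (x : S × ι → ℝ) :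
    B9Delta2Def134.Ineq3137b (calC L U₀ S {j} T w K e τ) x
      (fun _ => (L : ℝ) ^ j) (fun _ => ((L : ℝ) ^ j) ^ 2 * ‖coord (dir S e) x‖)
      (2 * d * C3Gen d L * ‖τ‖ * Me * c₀) M α₀ := by
  intro p
  have hL0 : (0 : ℝ) < (L : ℝ) ^ j := by positivity
  have hκ : 0 ≤ c₀ * M * α₀ * ((L : ℝ) ^ j) ^ (d - 2) := by positivity
  have h := abs_eq3136_apply_le L hL hG k U₀ hU₀ hα hα3 hα4 h52 hb hsmall hc₃ h145 h155 S {j} T w K e τ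
    (fun j' hj' => by rw [Finset.mem_singleton.mp hj']; exact hw) (fun _ => c₀ * M * α₀ * ((L : ℝ) ^ j) ^ (d - 2))
    (fun _ _ => hκ) (fun j' hj' => by rw [Finset.mem_singleton.mp hj']; exact hK)
    (fun j' hj' => by rw [Finset.mem_singleton.mp hj']; exact hj) x p
  rw [Finset.sum_singleton] at h
  refine h.trans ?_
  -- units: `(Lʲ)^{d−2}·(Lʲ)²·((Lʲ)^d)⁻¹ = 1` and `(Lʲ)⁻²·(Lʲ)² = 1`
  have hunit : ((L : ℝ) ^ j) ^ (d - 2) * (((L : ℝ) ^ j) ^ 2 * (((L : ℝ) ^ j) ^ d)⁻¹) = 1 := by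
    rw [← mul_assoc, ← pow_add, Nat.sub_add_cancel hd, mul_inv_cancel₀ (pow_ne_zero _ hL0.ne')]
  have hunit' : ((L : ℝ) ^ j)⁻¹ ^ 2 * ((L : ℝ) ^ j) ^ 2 = 1 := by
    rw [← mul_pow, inv_mul_cancel₀ hL0.ne', one_pow]
  have hA : 0 ≤ ‖coord (dir S e) x‖ := norm_nonneg _
  have hC := C3Gen_nonneg d L
  have hτ : 0 ≤ ‖τ‖ := norm_nonneg _
  have hei : ‖e p.2‖ ≤ Me := he p.2
  have he0 : 0 ≤ ‖e p.2‖ := norm_nonneg _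
  calc ‖τ‖ * (2 * d * (c₀ * M * α₀ * ((L : ℝ) ^ j) ^ (d - 2)) *
          (C3Gen d L * ((L : ℝ) ^ j) ^ 2 * (((L : ℝ) ^ j) ^ d)⁻¹) * ‖coord (dir S e) x‖ * ‖e p.2‖)
      = 2 * d * C3Gen d L * ‖τ‖ * (c₀ * M) * α₀ * ‖coord (dir S e) x‖ * ‖e p.2‖ *
          (((L : ℝ) ^ j) ^ (d - 2) * (((L : ℝ) ^ j) ^ 2 * (((L : ℝ) ^ j) ^ d)⁻¹)) := by ring
    _ = 2 * d * C3Gen d L * ‖τ‖ * (c₀ * M) * α₀ * ‖coord (dir S e) x‖ * ‖e p.2‖ := by rw [hunit, mul_one]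
    _ ≤ 2 * d * C3Gen d L * ‖τ‖ * (c₀ * M) * α₀ * ‖coord (dir S e) x‖ * Me :=
        mul_le_mul_of_nonneg_left hei (by positivity)
    _ = 2 * d * C3Gen d L * ‖τ‖ * Me * c₀ * M * α₀ * (((L : ℝ) ^ j)⁻¹ ^ 2 * ((L : ℝ) ^ j) ^ 2) *
          ‖coord (dir S e) x‖ := by rw [hunit']; ring
    _ = 2 * d * C3Gen d L * ‖τ‖ * Me * c₀ * M * α₀ * ((L : ℝ) ^ j)⁻¹ ^ 2 *
          (((L : ℝ) ^ j) ^ 2 * ‖coord (dir S e) x‖) := by ring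

/-! ## §5 (3.137) FOR THE CONCRETE `Δ⁽²⁾` WITH THE LOCAL SUPREMUM «over several j-blocks surrounding Δ(y)» (FILE 75
`B9Ineq3137LocalSup`: p06's per-level bounds with `‖P_c a‖` = print's `|A|_c` in place of the global `‖a‖`) -/

include hL hG hU₀ hα hα3 hα4 h52 hb hsmall hc₃ h145 h155 in
/-- **the (149)-display FOR THE CONCRETE `Δ⁽²⁾` WITH THE LOCAL `|A|_c`**: `|δx ⬝ᵥ Δ⁽²⁾x| ≤ ‖τ‖·Σ_j C₃(Lʲ)²·Σ_{c∈T_j} w_j(c)‖K_j(c)‖·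
‖P_c A(x)‖·Σ_s kerQdd_j(c,s)‖A(δx)_s‖` — «O(1)C₃Mα₀ΣΣ(Lʲη)^{d−2}(Q″_j|δA|)(c)|A|_c» with `|A|_c` the supremum over `B^j(c₋) ∪ B^j(c₊)` AS
PRINTED (v1's `abs_eq3136_pairing_le` has the global `‖A(x)‖`). [cite: Balaban1985BackgroundPropagators, (3.136) p.422, (3.137) p.423]
[cite: Balaban1985Averaging, (141) p.39, (149) p.40] -/
theorem abs_eq3136_pairing_le_local [Fintype ι] (hw : ∀ j ∈ lv, ∀ c ∈ T j, 0 ≤ w j c) (hJ : ∀ j ∈ lv, j ≤ k)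
    (x δx : S × ι → ℝ) :
    |δx ⬝ᵥ B9Delta2Def134.delta2 (calC L U₀ S lv T w K e τ) *ᵥ x| ≤
      ‖τ‖ * ∑ j ∈ lv, C3Gen d L * ((L : ℝ) ^ j) ^ 2 *
        ∑ c ∈ T j, w j c * ‖K j c‖ * ‖B9Ineq3137LocalSup.boxProj S L j c.1 c.2 (coord (dir S e) x)‖ *
          ∑ s : S, kerQdd L j c.1 c.2 s.1.1 s.1.2 * ‖coord (dir S e) δx s‖ := by
  rw [eq3136_concrete_pairing L hL hG k U₀ hU₀ hα hα3 hα4 h52 hb hsmall hc₃ S lv T w K e τ hJ, ← Real.norm_eq_abs]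
  refine (τ.le_opNorm _).trans (mul_le_mul_of_nonneg_left ?_ (norm_nonneg _))
  rw [fderiv_secondFormSum L hL hG k U₀ hU₀ hα hα3 hα4 h52 hb hsmall hc₃ S lv T w K hJ, polarSum_apply]
  refine norm_sum_le_of_le _ fun j hj => ?_
  rw [← (hasFDerivAt_levelForm L hL hG k U₀ hU₀ hα hα3 hα4 h52 hb hsmall hc₃ S T w K (hJ j hj) _).fderiv]
  exact B9Ineq3137LocalSup.norm_fderiv_secondForm_le_local L hL hG k U₀ hU₀ hα hα3 hα4 h52 hb hsmall hc₃ h145 h155 S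
    (T j) (w j) (K j) (hw j hj) (hJ j hj) _ _

include hL hG hU₀ hα hα3 hα4 h52 hb hsmall hc₃ h145 h155 in
/-- **(3.137) FOR THE CONCRETE `Δ⁽²⁾`, level sum, WITH «the supremum |A| … taken over several j-blocks surrounding Δ(y)»**: as v1's
`abs_eq3136_apply_le` but with, per level `j`, ANY number `A_loc(j)` dominating the local suprema `‖P_c A(x)‖` for the coarse bonds
`c ∈ T_j` whose box contains the fine bond `s = p.1` (FILE 75 `norm_fderiv_secondForm_single_le_local`):
`|(Δ⁽²⁾x)_{(s,i)}| ≤ ‖τ‖·(Σ_j 2d·κ_j·C₃(Lʲ)²·L^{−jd}·A_loc(j))·‖e_i‖`. [cite: Balaban1985BackgroundPropagators, (3.137) p.423]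
[cite: Balaban1985Averaging, (141)–(142) p.39, (149) p.40] -/
theorem abs_eq3136_apply_le_local [Fintype ι] (hw : ∀ j ∈ lv, ∀ c ∈ T j, 0 ≤ w j c) (κ : ℕ → ℝ) (hκ : ∀ j ∈ lv, 0 ≤ κ j)
    (hK : ∀ j ∈ lv, ∀ c ∈ T j, w j c * ‖K j c‖ ≤ κ j) (hJ : ∀ j ∈ lv, j ≤ k) (x : S × ι → ℝ) (p : S × ι)
    (Aloc : ℕ → ℝ) (hAloc0 : ∀ j ∈ lv, 0 ≤ Aloc j)
    (hAloc : ∀ j ∈ lv, ∀ c ∈ T j, B7Prop5Flat.BondIn (loK L j c.1) (bondHiK L j c.1 c.2) p.1.1.1 p.1.1.2 →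
      ‖B9Ineq3137LocalSup.boxProj S L j c.1 c.2 (coord (dir S e) x)‖ ≤ Aloc j) :
    |(B9Delta2Def134.delta2 (calC L U₀ S lv T w K e τ) *ᵥ x) p| ≤
      ‖τ‖ * ((∑ j ∈ lv, 2 * d * κ j * (C3Gen d L * ((L : ℝ) ^ j) ^ 2 * (((L : ℝ) ^ j) ^ d)⁻¹) * Aloc j) * ‖e p.2‖) := by
  classical
  rw [eq3136_concrete L hL hG k U₀ hU₀ hα hα3 hα4 h52 hb hsmall hc₃ S lv T w K e τ hJ, ← Real.norm_eq_abs]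
  refine (τ.le_opNorm _).trans (mul_le_mul_of_nonneg_left ?_ (norm_nonneg _))
  rw [fderiv_secondFormSum L hL hG k U₀ hU₀ hα hα3 hα4 h52 hb hsmall hc₃ S lv T w K hJ, polarSum_apply, dir_apply,
    Finset.sum_mul]
  refine norm_sum_le_of_le _ fun j hj => ?_
  rw [← (hasFDerivAt_levelForm L hL hG k U₀ hU₀ hα hα3 hα4 h52 hb hsmall hc₃ S T w K (hJ j hj) _).fderiv]
  exact B9Ineq3137LocalSup.norm_fderiv_secondForm_single_le_local L hL hG k U₀ hU₀ hα hα3 hα4 h52 hb hsmall hc₃ h145 h155 S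
    (T j) (w j) (K j) (hw j hj) (hκ j hj) (hK j hj) (hJ j hj) _ p.1 (e p.2) (hAloc0 j hj) (hAloc j hj)

/-! ## §6 «This bound implies that the operators Δ⁽²⁾, Δ⁽²⁾_π are small in a proper sense, if α₀ is sufficiently small» (p. 423)
— ONE proper sense for the concrete `Δ⁽²⁾`: its `ℓ^∞ → ℓ^∞` operator size on real coordinates is `≤ O(1)·Mα₀` -/

omit [CompleteSpace 𝔸] [NormOneClass 𝔸] in
/-- `‖A(x)‖ ≤ (Σ_i ‖e_i‖)·‖x‖_∞`. [cite: Balaban1985BackgroundPropagators, (3.137) p.423] -/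
theorem norm_coord_dir_le [Fintype ι] (x : S × ι → ℝ) : ‖coord (dir S e) x‖ ≤ (∑ i, ‖e i‖) * ‖x‖ := by
  refine (pi_norm_le_iff_of_nonneg (by positivity)).2 fun s => ?_
  refine (norm_coord_dir_apply_le S e x s).trans ?_
  rw [Finset.sum_mul]
  refine Finset.sum_le_sum fun i _ => mul_le_mul_of_nonneg_left ?_ (norm_nonneg _)
  rw [← Real.norm_eq_abs]
  exact norm_le_pi_norm x (s, i)

include hL hG hU₀ hα hα3 hα4 h52 hb hsmall hc₃ h145 h155 in
/-- **«small in a proper sense» FOR THE CONCRETE `Δ⁽²⁾` (one reading: the `ℓ^∞ → ℓ^∞` size on real coordinates)**: under the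
printed `(H*J)`-budget `w_j(c)‖K_j(c)‖ ≤ c₀·M·α₀·(Lʲ)^{d−2}` on every level of `lv` («(Lʲη)^{d+1}·O(1)Mα₀(Lʲη)⁻³»),
`‖Δ⁽²⁾x‖_∞ ≤ [2d·C₃·‖τ‖·(Σ_i‖e_i‖)·M_e·c₀·#lv]·(Mα₀)·‖x‖_∞` — `O(1)·Mα₀`, small for `α₀` small (the levels of `lv` each
contribute once: print's one-level localisation of the fine bond is a property of `𝔅`, located in the file header (iii)).
[cite: Balaban1985BackgroundPropagators, (3.137) p.423] [cite: Balaban1985Averaging, (141)–(142) p.39, (149) p.40] -/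
theorem norm_delta2_calC_mulVec_le [Fintype ι] (hd : 2 ≤ d) (hJ : ∀ j ∈ lv, j ≤ k) (hw : ∀ j ∈ lv, ∀ c ∈ T j, 0 ≤ w j c)
    {c₀ M Me : ℝ} (hc₀ : 0 ≤ c₀ * M) (he : ∀ i, ‖e i‖ ≤ Me)
    (hK : ∀ j ∈ lv, ∀ c ∈ T j, w j c * ‖K j c‖ ≤ c₀ * M * α₀ * ((L : ℝ) ^ j) ^ (d - 2)) (x : S × ι → ℝ) :
    ‖B9Delta2Def134.delta2 (calC L U₀ S lv T w K e τ) *ᵥ x‖ ≤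
      (2 * d * C3Gen d L * ‖τ‖ * (∑ i, ‖e i‖) * Me * c₀ * lv.card) * (M * α₀) * ‖x‖ := by
  have hC := C3Gen_nonneg d L
  have hE : 0 ≤ ∑ i, ‖e i‖ := Finset.sum_nonneg fun i _ => norm_nonneg _
  rcases isEmpty_or_nonempty ι with hι | ⟨⟨i₀⟩⟩
  · -- no directions: both sides vanish
    have h0 : B9Delta2Def134.delta2 (calC L U₀ S lv T w K e τ) *ᵥ x = 0 := Subsingleton.elim _ _
    rw [h0, norm_zero, Finset.univ_eq_empty, Finset.sum_empty]
    simp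
  have hMe : 0 ≤ Me := (norm_nonneg _).trans (he i₀)
  have hRHS : 0 ≤ (2 * d * C3Gen d L * ‖τ‖ * (∑ i, ‖e i‖) * Me * c₀ * lv.card) * (M * α₀) * ‖x‖ := by
    have : 0 ≤ c₀ * M * α₀ := mul_nonneg hc₀ hα.le
    have h1 : (2 * d * C3Gen d L * ‖τ‖ * (∑ i, ‖e i‖) * Me * c₀ * lv.card) * (M * α₀) * ‖x‖ =
        2 * d * C3Gen d L * ‖τ‖ * (∑ i, ‖e i‖) * Me * lv.card * (c₀ * M * α₀) * ‖x‖ := by ring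
    rw [h1]; positivity
  refine (pi_norm_le_iff_of_nonneg hRHS).2 fun p => ?_
  rw [Real.norm_eq_abs]
  -- (3.137) for the level sum with the printed budget
  have hκ : ∀ j ∈ lv, 0 ≤ c₀ * M * α₀ * ((L : ℝ) ^ j) ^ (d - 2) := fun j _ => by
    have : 0 ≤ c₀ * M * α₀ := mul_nonneg hc₀ hα.le
    positivity
  have h := abs_eq3136_apply_le L hL hG k U₀ hU₀ hα hα3 hα4 h52 hb hsmall hc₃ h145 h155 S lv T w K e τ hw
    (fun j => c₀ * M * α₀ * ((L : ℝ) ^ j) ^ (d - 2)) hκ hK hJ x p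
  refine h.trans ?_
  -- the level sum collapses: `(Lʲ)^{d−2}·(Lʲ)²·((Lʲ)^d)⁻¹ = 1`
  have hunit : ∀ j : ℕ, ((L : ℝ) ^ j) ^ (d - 2) * (((L : ℝ) ^ j) ^ 2 * (((L : ℝ) ^ j) ^ d)⁻¹) = 1 := by
    intro j
    have hL0 : (0 : ℝ) < (L : ℝ) ^ j := by positivity
    rw [← mul_assoc, ← pow_add, Nat.sub_add_cancel hd, mul_inv_cancel₀ (pow_ne_zero _ hL0.ne')]
  have hsum : ∑ j ∈ lv, 2 * (d : ℝ) * (c₀ * M * α₀ * ((L : ℝ) ^ j) ^ (d - 2)) *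
        (C3Gen d L * ((L : ℝ) ^ j) ^ 2 * (((L : ℝ) ^ j) ^ d)⁻¹) = lv.card * (2 * d * C3Gen d L * (c₀ * M * α₀)) := by
    rw [Finset.sum_congr rfl fun j _ => show 2 * (d : ℝ) * (c₀ * M * α₀ * ((L : ℝ) ^ j) ^ (d - 2)) *
        (C3Gen d L * ((L : ℝ) ^ j) ^ 2 * (((L : ℝ) ^ j) ^ d)⁻¹) = 2 * d * C3Gen d L * (c₀ * M * α₀) from by
          rw [show 2 * (d : ℝ) * (c₀ * M * α₀ * ((L : ℝ) ^ j) ^ (d - 2)) * (C3Gen d L * ((L : ℝ) ^ j) ^ 2 * (((L : ℝ) ^ j) ^ d)⁻¹)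
              = 2 * d * C3Gen d L * (c₀ * M * α₀) * (((L : ℝ) ^ j) ^ (d - 2) * (((L : ℝ) ^ j) ^ 2 * (((L : ℝ) ^ j) ^ d)⁻¹)) by ring,
            hunit j, mul_one],
      Finset.sum_const, nsmul_eq_mul]
  rw [hsum]
  have hA := norm_coord_dir_le S e x
  have hep : ‖e p.2‖ ≤ Me := he p.2
  have hcore : 0 ≤ ‖τ‖ * (lv.card * (2 * d * C3Gen d L * (c₀ * M * α₀))) := by
    have : 0 ≤ c₀ * M * α₀ := mul_nonneg hc₀ hα.le
    positivity
  calc ‖τ‖ * (lv.card * (2 * d * C3Gen d L * (c₀ * M * α₀)) * ‖coord (dir S e) x‖ * ‖e p.2‖)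
      = ‖τ‖ * (lv.card * (2 * d * C3Gen d L * (c₀ * M * α₀))) * (‖coord (dir S e) x‖ * ‖e p.2‖) := by ring
    _ ≤ ‖τ‖ * (lv.card * (2 * d * C3Gen d L * (c₀ * M * α₀))) * ((∑ i, ‖e i‖) * ‖x‖ * Me) :=
        mul_le_mul_of_nonneg_left (mul_le_mul hA hep (norm_nonneg _) (by positivity)) hcore
    _ = (2 * d * C3Gen d L * ‖τ‖ * (∑ i, ‖e i‖) * Me * c₀ * lv.card) * (M * α₀) * ‖x‖ := by ring

end Concrete

/-! ## §7 `Δ⁽²⁾` AS A FINITE-RANGE, SMALL BLOCK OPERATOR — the `B6RandomWalk.HasMajorant` letter ([4] (2.51) «|(Tλ)(x)| ≤ K(y,y′)|λ|,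
x ∈ B^j(y), supp λ ⊂ B^{j′}(y′)») of the random-walk expansion (3.138) for the concrete `Δ⁽²⁾ = delta2 calC`: (3.137) with its LOCAL
supremum says that the `(b,i),(b′,i′)` entry vanishes unless the fine bonds `b`, `b′` lie in the box of a common coarse bond, and is
`O(1)·Mα₀` otherwise — the input shape `θ·e^{−δ d(y,y′)}` of the (3.138) bookkeeping (`B9SectDL2Decay.rightEntry_majorant`'s `hT'`, through
r16's conservative `B11SectG.hasMaj_of_hasMajorant`) for ANY block map `blk : S × ι → 𝔅` and any rate `δ ≥ 0`, given the range `R` of the boxes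
in the distance of `𝔅` -/

section Majorant

open NormedSpace Finset Metric Filter
open B7Prop1Explicit B7Prop1Local B7Prop2Explicit B7Prop3Flat B7Prop4Flat B7Eq92Concrete B7Prop3GeneralLinear
  B7Prop4GeneralLevels B7Prop5GeneralOperators B7Prop5GeneralInduction B7Prop5GeneralLevels B7Ineq149Pairing B7Eq136SecondOrder
  B9Ineq3137From149

variable {d : ℕ}
variable {𝔸 : Type*} [NormedRing 𝔸] [NormedAlgebra ℂ 𝔸] [CompleteSpace 𝔸] [NormOneClass 𝔸]

variable (L : ℕ) (hL : 2 ≤ L) {G : Subgroup 𝔸ˣ} (hG : AvgClosed d L G) (k : ℕ)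
  (U₀ : B7Prop1Explicit.Site d → Fin d → 𝔸ˣ) (hU₀ : ∀ x κ, U₀ x κ ∈ G) {α₀ : ℝ} (hα : 0 < α₀)
  (hα3 : C0 d * α₀ ≤ 1 / 3) (hα4 : 4 * α₀ ≤ c2' d L) (h52 : pdev U₀ < α₀ * (((L : ℝ) ^ k)⁻¹) ^ 2)
  {b : ℝ} (hb : 0 < b)
  (hsmall : Real.exp (4 * (800 * ((d : ℝ) + 1) ^ 2 * ((d : ℝ) + 4)) * α₀)
    * (1 + 8 * (131072 * ((d : ℝ) + 1) ^ 2) * ((L : ℝ) ^ k * b)) ≤ 2)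
  (hc₃ : 4 * ((L : ℝ) ^ k * b) < c3 d L)
  (h145 : 8 * d * thetaGen d L α₀ * (L : ℝ)⁻¹ ^ 4 ≤ 1)
  (h155 : (2 * (L : ℝ) - 1) * (L : ℝ)⁻¹ ^ 2 + 2 * d * thetaGen d L α₀ * (L : ℝ)⁻¹ ^ 3
    + 1 / 8 * (1 + 2 * d * thetaGen d L α₀ * (L : ℝ)⁻¹ ^ 2 + 2 * d * C3Gen d L * ((L : ℝ) ^ k * b)) * (L : ℝ)⁻¹ ^ 2 ≤ 1)
  (S : Finset (B7Prop1Explicit.Site d × Fin d))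
  (lv : Finset ℕ) (T : ℕ → Finset (B7Prop1Explicit.Site d × Fin d)) (w : ℕ → B7Prop1Explicit.Site d × Fin d → ℝ)
  (K : ℕ → B7Prop1Explicit.Site d × Fin d → 𝔸)

-- the real directions live in `Type` here (`B6.Geometry.Site : Type` and `B6RandomWalk.HasMajorant`'s lattice `X : Type`)
variable {ι : Type} [Fintype ι] (e : ι → 𝔸) (τ : 𝔸 →L[ℝ] ℝ)
variable {g : B6.Geometry} (blk : S × ι → g.Site)

/-- «b ∈ Δ(y)» bookkeeping for an abstract block map `blk : S × ι → 𝔅` (print: `Δ(y) = B^j(y)` for `y ∈ Λ_j`, p. 398; here `blk (b,i) = y` reads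
«the real coordinate `(b,i)` belongs to the block `y`»): **the block `y` MEETS the box `B^j(c₋) ∪ B^j(c₊)` of the coarse bond `c`** — some coordinate
of the block has its fine bond in the box. [cite: Balaban1985BackgroundPropagators, (3.137) p.423]
[cite: Balaban1984PropagatorsII, (2.51) p.232] -/
def BoxMeets (j : ℕ) (c : B7Prop1Explicit.Site d × Fin d) (y : g.Site) : Prop :=
  ∃ p : S × ι, blk p = y ∧ B7Prop5Flat.BondIn (loK L j c.1) (bondHiK L j c.1 c.2) p.1.1.1 p.1.1.2

open Classical in
/-- **the RANGE of the level-`j` piece of `Δ⁽²⁾`**: `𝟙[the blocks y and y′ both meet the box of a common coarse bond c ∈ T_j]` («the supremum |A| is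
taken over several j-blocks surrounding Δ(y)», p. 423). [cite: Balaban1985BackgroundPropagators, (3.137) p.423] -/
def levelRange (j : ℕ) (y y' : g.Site) : ℝ :=
  if ∃ c ∈ T j, BoxMeets L S blk j c y ∧ BoxMeets L S blk j c y' then 1 else 0

omit [Fintype ι] in
/-- `levelRange ∈ {0, 1}`: non-negative. [cite: Balaban1985BackgroundPropagators, (3.137) p.423] -/
theorem levelRange_nonneg (j : ℕ) (y y' : g.Site) : 0 ≤ levelRange L S T blk j y y' := by
  unfold levelRange; split_ifs <;> norm_num

omit [Fintype ι] in
/-- `levelRange ≤ 1`. [cite: Balaban1985BackgroundPropagators, (3.137) p.423] -/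
theorem levelRange_le_one (j : ℕ) (y y' : g.Site) : levelRange L S T blk j y y' ≤ 1 := by
  unfold levelRange; split_ifs <;> norm_num

omit [Fintype ι] in
/-- in range: `levelRange = 1`. [cite: Balaban1985BackgroundPropagators, (3.137) p.423] -/
theorem levelRange_eq_one {j : ℕ} {y y' : g.Site} {c : B7Prop1Explicit.Site d × Fin d} (hc : c ∈ T j)
    (hy : BoxMeets L S blk j c y) (hy' : BoxMeets L S blk j c y') : levelRange L S T blk j y y' = 1 := by
  unfold levelRange; exact if_pos ⟨c, hc, hy, hy'⟩

omit [Fintype ι] in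
/-- out of range: `levelRange = 0`. [cite: Balaban1985BackgroundPropagators, (3.137) p.423] -/
theorem levelRange_eq_zero {j : ℕ} {y y' : g.Site} (h : ¬ ∃ c ∈ T j, BoxMeets L S blk j c y ∧ BoxMeets L S blk j c y') :
    levelRange L S T blk j y y' = 0 := by
  unfold levelRange; exact if_neg h

omit [CompleteSpace 𝔸] [NormOneClass 𝔸] in
/-- a coordinate vector supported in the block `Δ(y′)` with `|μ| ≤ B` gives a configuration with `‖P_c A(μ)‖ ≤ (Σ_i‖e_i‖)·B` on every box.
[cite: Balaban1985BackgroundPropagators, (3.137) p.423] [cite: Balaban1984PropagatorsII, (2.51) p.232] -/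
theorem norm_boxProj_coord_le_of_blockSupp (j : ℕ) (c : B7Prop1Explicit.Site d × Fin d) {μ : S × ι → ℝ} {y' : g.Site} {B : ℝ}
    (hμ : B6RandomWalk.BlockSupp blk μ y' B) :
    ‖B9Ineq3137LocalSup.boxProj S L j c.1 c.2 (coord (dir S e) μ)‖ ≤ (∑ i, ‖e i‖) * B := by
  have hE : 0 ≤ ∑ i, ‖e i‖ := Finset.sum_nonneg fun i _ => norm_nonneg _
  refine (B9Ineq3137LocalSup.norm_boxProj_le S L j c.1 c.2 _).trans ?_
  refine (pi_norm_le_iff_of_nonneg (mul_nonneg hE hμ.nonneg)).2 fun s => ?_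
  refine (norm_coord_dir_apply_le S e μ s).trans ?_
  rw [Finset.sum_mul]
  refine Finset.sum_le_sum fun i _ => mul_le_mul_of_nonneg_left ?_ (norm_nonneg _)
  by_cases hsi : blk (s, i) = y'
  · exact hμ.bound _ hsi
  · rw [hμ.off _ hsi, abs_zero]; exact hμ.nonneg

omit [CompleteSpace 𝔸] [NormOneClass 𝔸] in
/-- … and `P_c A(μ) = 0` on every box that the block `Δ(y′)` does NOT meet — THE LOCALITY behind the finite range.
[cite: Balaban1985BackgroundPropagators, (3.137) p.423] [cite: Balaban1984PropagatorsII, (2.51) p.232] -/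
theorem boxProj_coord_eq_zero_of_not_boxMeets (j : ℕ) (c : B7Prop1Explicit.Site d × Fin d) {μ : S × ι → ℝ} {y' : g.Site}
    {B : ℝ} (hμ : B6RandomWalk.BlockSupp blk μ y' B) (hm : ¬ BoxMeets L S blk j c y') :
    B9Ineq3137LocalSup.boxProj S L j c.1 c.2 (coord (dir S e) μ) = 0 := by
  funext s
  rw [B9Ineq3137LocalSup.boxProj_apply, Pi.zero_apply]
  split_ifs with hs
  · rw [coord_dir_apply]
    refine Finset.sum_eq_zero fun i _ => ?_
    have h0 : μ (s, i) = 0 := by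
      by_cases hsi : blk (s, i) = y'
      · exact absurd ⟨(s, i), hsi, hs⟩ hm
      · exact hμ.off _ hsi
    rw [h0, Complex.ofReal_zero, zero_smul]
  · rfl

include hL hG hU₀ hα hα3 hα4 h52 hb hsmall hc₃ h145 h155 in
/-- **`Δ⁽²⁾` HAS A FINITE-RANGE BLOCK MAJORANT** ([4] (2.51)) over ANY block map `blk : S × ι → 𝔅`:
`K(y,y′) = ‖τ‖·[Σ_{j∈lv} 2dκ_j·C₃(Lʲ)²L^{−jd}·(Σ_i‖e_i‖)·𝟙_j(y,y′)]·M_e` with `𝟙_j(y,y′) = levelRange` = «Δ(y) and Δ(y′) both meet the box of a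
common coarse bond of T_j» — (3.137) with the local supremum (`abs_eq3136_apply_le_local`) READ AS A MAJORANT: for `supp μ ⊂ Δ(y′)`, `|μ| ≤ B`,
`|(Δ⁽²⁾μ)(b,i)| ≤ K(y,y′)·B` for `(b,i) ∈ Δ(y)`. [cite: Balaban1985BackgroundPropagators, (3.137)–(3.138) p.423]
[cite: Balaban1984PropagatorsII, (2.51) p.232] [cite: Balaban1985Averaging, (141)–(142) p.39, (149) p.40] -/
theorem hasMajorant_delta2_calC (hw : ∀ j ∈ lv, ∀ c ∈ T j, 0 ≤ w j c) (κ : ℕ → ℝ) (hκ : ∀ j ∈ lv, 0 ≤ κ j)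
    (hK : ∀ j ∈ lv, ∀ c ∈ T j, w j c * ‖K j c‖ ≤ κ j) (hJ : ∀ j ∈ lv, j ≤ k) {Me : ℝ} (he : ∀ i, ‖e i‖ ≤ Me) :
    B6RandomWalk.HasMajorant blk (Matrix.mulVecLin (B9Delta2Def134.delta2 (calC L U₀ S lv T w K e τ)))
      (fun y y' => ‖τ‖ * ((∑ j ∈ lv, 2 * d * κ j * (C3Gen d L * ((L : ℝ) ^ j) ^ 2 * (((L : ℝ) ^ j) ^ d)⁻¹) *
        ((∑ i, ‖e i‖) * levelRange L S T blk j y y')) * Me)) := by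
  intro y' μ B hμ p
  rw [Matrix.mulVecLin_apply]
  have hE : 0 ≤ ∑ i, ‖e i‖ := Finset.sum_nonneg fun i _ => norm_nonneg _
  have hC := C3Gen_nonneg d L
  -- (3.137) with the LOCAL dominants `Aloc_j = (Σ_i‖e_i‖)·B·𝟙_j(blk p, y′)`
  have hAloc0 : ∀ j ∈ lv, 0 ≤ (∑ i, ‖e i‖) * B * levelRange L S T blk j (blk p) y' := fun j _ =>
    mul_nonneg (mul_nonneg hE hμ.nonneg) (levelRange_nonneg L S T blk j _ _)
  have hAloc : ∀ j ∈ lv, ∀ c ∈ T j, B7Prop5Flat.BondIn (loK L j c.1) (bondHiK L j c.1 c.2) p.1.1.1 p.1.1.2 →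
      ‖B9Ineq3137LocalSup.boxProj S L j c.1 c.2 (coord (dir S e) μ)‖ ≤ (∑ i, ‖e i‖) * B * levelRange L S T blk j (blk p) y' := by
    intro j hj c hc hs
    by_cases hm : BoxMeets L S blk j c y'
    · rw [levelRange_eq_one L S T blk hc ⟨p, rfl, hs⟩ hm, mul_one]
      exact norm_boxProj_coord_le_of_blockSupp L S e blk j c hμ
    · rw [boxProj_coord_eq_zero_of_not_boxMeets L S e blk j c hμ hm, norm_zero]
      exact hAloc0 j hj
  have h := abs_eq3136_apply_le_local L hL hG k U₀ hU₀ hα hα3 hα4 h52 hb hsmall hc₃ h145 h155 S lv T w K e τ hw κ hκ hK hJ μ p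
    (fun j => (∑ i, ‖e i‖) * B * levelRange L S T blk j (blk p) y') hAloc0 hAloc
  refine h.trans ?_
  -- pull `B` out of the level sum and bound `‖e_{p.2}‖ ≤ M_e`
  have hpull : ∑ j ∈ lv, 2 * (d : ℝ) * κ j * (C3Gen d L * ((L : ℝ) ^ j) ^ 2 * (((L : ℝ) ^ j) ^ d)⁻¹) *
        ((∑ i, ‖e i‖) * B * levelRange L S T blk j (blk p) y') =
      B * ∑ j ∈ lv, 2 * (d : ℝ) * κ j * (C3Gen d L * ((L : ℝ) ^ j) ^ 2 * (((L : ℝ) ^ j) ^ d)⁻¹) *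
        ((∑ i, ‖e i‖) * levelRange L S T blk j (blk p) y') := by
    symm
    rw [Finset.mul_sum]
    exact Finset.sum_congr rfl fun j _ => by ring
  have hS0 : 0 ≤ ∑ j ∈ lv, 2 * (d : ℝ) * κ j * (C3Gen d L * ((L : ℝ) ^ j) ^ 2 * (((L : ℝ) ^ j) ^ d)⁻¹) *
      ((∑ i, ‖e i‖) * levelRange L S T blk j (blk p) y') :=
    Finset.sum_nonneg fun j hj => by
      have := hκ j hj
      have := levelRange_nonneg L S T blk j (blk p) y'
      positivity
  rw [hpull]
  calc ‖τ‖ * (B * (∑ j ∈ lv, 2 * (d : ℝ) * κ j * (C3Gen d L * ((L : ℝ) ^ j) ^ 2 * (((L : ℝ) ^ j) ^ d)⁻¹) *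
          ((∑ i, ‖e i‖) * levelRange L S T blk j (blk p) y')) * ‖e p.2‖)
      = ‖τ‖ * ((∑ j ∈ lv, 2 * (d : ℝ) * κ j * (C3Gen d L * ((L : ℝ) ^ j) ^ 2 * (((L : ℝ) ^ j) ^ d)⁻¹) *
          ((∑ i, ‖e i‖) * levelRange L S T blk j (blk p) y')) * ‖e p.2‖) * B := by ring
    _ ≤ ‖τ‖ * ((∑ j ∈ lv, 2 * (d : ℝ) * κ j * (C3Gen d L * ((L : ℝ) ^ j) ^ 2 * (((L : ℝ) ^ j) ^ d)⁻¹) *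
          ((∑ i, ‖e i‖) * levelRange L S T blk j (blk p) y')) * Me) * B :=
        mul_le_mul_of_nonneg_right
          (mul_le_mul_of_nonneg_left (mul_le_mul_of_nonneg_left (he p.2) hS0) (norm_nonneg _)) hμ.nonneg

omit [NormedRing 𝔸] [NormedAlgebra ℂ 𝔸] [CompleteSpace 𝔸] [NormOneClass 𝔸] in
/-- units bookkeeping: `(Lʲ)^{d−2}·(Lʲ)²·L^{−jd} = 1` for `d ≥ 2` (the printed budget «(Lʲη)^{d+1}·(Lʲη)⁻³» against «(Lʲη)⁻²|A|»).
[cite: Balaban1985BackgroundPropagators, (3.137) p.423] -/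
theorem pow_budget_collapse (hd : 2 ≤ d) (hL : 2 ≤ L) (j : ℕ) :
    ((L : ℝ) ^ j) ^ (d - 2) * (((L : ℝ) ^ j) ^ 2 * (((L : ℝ) ^ j) ^ d)⁻¹) = 1 := by
  have hL0 : (0 : ℝ) < (L : ℝ) ^ j := by
    have : (0 : ℝ) < L := by exact_mod_cast (by omega : 0 < L)
    positivity
  rw [← mul_assoc, ← pow_add, Nat.sub_add_cancel hd, mul_inv_cancel₀ (pow_ne_zero _ hL0.ne')]

include hL hG hU₀ hα hα3 hα4 h52 hb hsmall hc₃ h145 h155 in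
/-- **THE INPUT LETTER OF THE EXPANSION (3.138) FOR `Δ⁽²⁾`** — «This bound implies that the operators Δ⁽²⁾, Δ⁽²⁾_π are small in a proper sense,
if α₀ is sufficiently small» (p. 423) in the sense USED by the random-walk expansion ([4] (2.51)–(2.55)): under the printed `(H*J)`-budget
`w_j(c)‖K_j(c)‖ ≤ c₀Mα₀(Lʲ)^{d−2}` (`2 ≤ d`), `‖e_i‖ ≤ M_e`, and the RANGE HYPOTHESIS `hR` on the abstract geometry — `d(y,y′) ≤ R` whenever the
blocks `Δ(y)`, `Δ(y′)` meet the box of a common coarse bond of a level of `lv` (print: the box of `c` is `B^j(c₋) ∪ B^j(c₊)`, two neighbouring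
`j`-blocks — «several j-blocks surrounding Δ(y)» — so `R = O(1)` in the distance (2.46) of [4]; a hypothesis letter here, the flat carrier does
not model `𝔅`) — `Δ⁽²⁾` has the block majorant `θ·e^{δR}·e^{−δ·d(y,y′)}` for EVERY rate `δ ≥ 0`, with
`θ = [2dC₃‖τ‖(Σ_i‖e_i‖)M_e c₀·#lv]·(Mα₀)` the constant of `norm_delta2_calC_mulVec_le` — `O(1)·Mα₀`.
[cite: Balaban1985BackgroundPropagators, (3.137)–(3.138) p.423] [cite: Balaban1984PropagatorsII, (2.51)–(2.55) p.232]
[cite: Balaban1985Averaging, (141)–(142) p.39, (149) p.40] -/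
theorem hasMajorant_delta2_calC_exp (hd : 2 ≤ d) (hJ : ∀ j ∈ lv, j ≤ k) (hw : ∀ j ∈ lv, ∀ c ∈ T j, 0 ≤ w j c)
    {c₀ M Me : ℝ} (hc₀ : 0 ≤ c₀ * M) (hMe : 0 ≤ Me) (he : ∀ i, ‖e i‖ ≤ Me)
    (hK : ∀ j ∈ lv, ∀ c ∈ T j, w j c * ‖K j c‖ ≤ c₀ * M * α₀ * ((L : ℝ) ^ j) ^ (d - 2))
    {R δ : ℝ} (hδ : 0 ≤ δ)
    (hR : ∀ j ∈ lv, ∀ c ∈ T j, ∀ y y' : g.Site, BoxMeets L S blk j c y → BoxMeets L S blk j c y' → g.dist y y' ≤ R) :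
    B6RandomWalk.HasMajorant blk (Matrix.mulVecLin (B9Delta2Def134.delta2 (calC L U₀ S lv T w K e τ)))
      (fun y y' => (2 * d * C3Gen d L * ‖τ‖ * (∑ i, ‖e i‖) * Me * c₀ * lv.card) * (M * α₀) * Real.exp (δ * R) *
        Real.exp (-(δ * g.dist y y'))) := by
  have hE : 0 ≤ ∑ i, ‖e i‖ := Finset.sum_nonneg fun i _ => norm_nonneg _
  have hC := C3Gen_nonneg d L
  have hcMα : 0 ≤ c₀ * M * α₀ := mul_nonneg hc₀ hα.le
  have hκ : ∀ j ∈ lv, 0 ≤ c₀ * M * α₀ * ((L : ℝ) ^ j) ^ (d - 2) := fun j _ => by positivity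
  refine B6RandomWalk.hasMajorant_mono blk
    (hasMajorant_delta2_calC L hL hG k U₀ hU₀ hα hα3 hα4 h52 hb hsmall hc₃ h145 h155 S lv T w K e τ blk hw
      (fun j => c₀ * M * α₀ * ((L : ℝ) ^ j) ^ (d - 2)) hκ hK hJ he) fun y y' => ?_
  -- the common value of the bound on its support: `θ·(Mα₀)` with the level sum collapsed by `pow_budget_collapse`
  have hθ0 : 0 ≤ (2 * d * C3Gen d L * ‖τ‖ * (∑ i, ‖e i‖) * Me * c₀ * lv.card) * (M * α₀) := by
    rw [show (2 * d * C3Gen d L * ‖τ‖ * (∑ i, ‖e i‖) * Me * c₀ * lv.card) * (M * α₀) =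
        2 * d * C3Gen d L * ‖τ‖ * (∑ i, ‖e i‖) * Me * lv.card * (c₀ * M * α₀) by ring]
    positivity
  by_cases hyy : ∃ j ∈ lv, ∃ c ∈ T j, BoxMeets L S blk j c y ∧ BoxMeets L S blk j c y'
  · -- in range: `d(y,y′) ≤ R`, so `1 ≤ e^{δR}e^{−δd(y,y′)}`; and `𝟙_j ≤ 1` on every level
    obtain ⟨j₀, hj₀, c, hc, hy, hy'⟩ := hyy
    have hdist : g.dist y y' ≤ R := hR j₀ hj₀ c hc y y' hy hy'
    have hexp : 1 ≤ Real.exp (δ * R) * Real.exp (-(δ * g.dist y y')) := by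
      rw [← Real.exp_add]
      exact Real.one_le_exp (by nlinarith)
    have hlev : ∀ j ∈ lv, 2 * (d : ℝ) * (c₀ * M * α₀ * ((L : ℝ) ^ j) ^ (d - 2)) *
        (C3Gen d L * ((L : ℝ) ^ j) ^ 2 * (((L : ℝ) ^ j) ^ d)⁻¹) * ((∑ i, ‖e i‖) * levelRange L S T blk j y y') ≤
        2 * d * C3Gen d L * (c₀ * M * α₀) * ∑ i, ‖e i‖ := by
      intro j hj
      have h1 := levelRange_le_one L S T blk j y y'
      calc 2 * (d : ℝ) * (c₀ * M * α₀ * ((L : ℝ) ^ j) ^ (d - 2)) * (C3Gen d L * ((L : ℝ) ^ j) ^ 2 * (((L : ℝ) ^ j) ^ d)⁻¹) *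
            ((∑ i, ‖e i‖) * levelRange L S T blk j y y')
          = 2 * d * C3Gen d L * (c₀ * M * α₀) * (∑ i, ‖e i‖) *
              (((L : ℝ) ^ j) ^ (d - 2) * (((L : ℝ) ^ j) ^ 2 * (((L : ℝ) ^ j) ^ d)⁻¹)) * levelRange L S T blk j y y' := by ring
        _ = 2 * d * C3Gen d L * (c₀ * M * α₀) * (∑ i, ‖e i‖) * levelRange L S T blk j y y' := by
              rw [pow_budget_collapse L hd hL j, mul_one]
        _ ≤ 2 * d * C3Gen d L * (c₀ * M * α₀) * (∑ i, ‖e i‖) * 1 := by gcongr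
        _ = 2 * d * C3Gen d L * (c₀ * M * α₀) * ∑ i, ‖e i‖ := mul_one _
    have hsum : ∑ j ∈ lv, 2 * (d : ℝ) * (c₀ * M * α₀ * ((L : ℝ) ^ j) ^ (d - 2)) *
        (C3Gen d L * ((L : ℝ) ^ j) ^ 2 * (((L : ℝ) ^ j) ^ d)⁻¹) * ((∑ i, ‖e i‖) * levelRange L S T blk j y y') ≤
        lv.card * (2 * d * C3Gen d L * (c₀ * M * α₀) * ∑ i, ‖e i‖) := by
      refine (Finset.sum_le_sum hlev).trans ?_
      rw [Finset.sum_const, nsmul_eq_mul]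
    calc ‖τ‖ * ((∑ j ∈ lv, 2 * (d : ℝ) * (c₀ * M * α₀ * ((L : ℝ) ^ j) ^ (d - 2)) *
            (C3Gen d L * ((L : ℝ) ^ j) ^ 2 * (((L : ℝ) ^ j) ^ d)⁻¹) * ((∑ i, ‖e i‖) * levelRange L S T blk j y y')) * Me)
        ≤ ‖τ‖ * ((lv.card * (2 * d * C3Gen d L * (c₀ * M * α₀) * ∑ i, ‖e i‖)) * Me) :=
          mul_le_mul_of_nonneg_left (mul_le_mul_of_nonneg_right hsum hMe) (norm_nonneg _)
      _ = (2 * d * C3Gen d L * ‖τ‖ * (∑ i, ‖e i‖) * Me * c₀ * lv.card) * (M * α₀) * 1 := by ring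
      _ ≤ (2 * d * C3Gen d L * ‖τ‖ * (∑ i, ‖e i‖) * Me * c₀ * lv.card) * (M * α₀) *
            (Real.exp (δ * R) * Real.exp (-(δ * g.dist y y'))) := mul_le_mul_of_nonneg_left hexp hθ0
      _ = (2 * d * C3Gen d L * ‖τ‖ * (∑ i, ‖e i‖) * Me * c₀ * lv.card) * (M * α₀) * Real.exp (δ * R) *
            Real.exp (-(δ * g.dist y y')) := by ring
  · -- out of range: every level indicator vanishes and the bound is `0 ≤ θ e^{δR} e^{−δd}`
    have h0 : ∀ j ∈ lv, levelRange L S T blk j y y' = 0 := fun j hj =>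
      levelRange_eq_zero L S T blk fun ⟨c, hc, hy, hy'⟩ => hyy ⟨j, hj, c, hc, hy, hy'⟩
    have hs0 : ∑ j ∈ lv, 2 * (d : ℝ) * (c₀ * M * α₀ * ((L : ℝ) ^ j) ^ (d - 2)) *
        (C3Gen d L * ((L : ℝ) ^ j) ^ 2 * (((L : ℝ) ^ j) ^ d)⁻¹) * ((∑ i, ‖e i‖) * levelRange L S T blk j y y') = 0 :=
      Finset.sum_eq_zero fun j hj => by rw [h0 j hj, mul_zero, mul_zero]
    rw [hs0, zero_mul, mul_zero]
    positivity

include hL hG hU₀ hα hα3 hα4 h52 hb hsmall hc₃ h145 h155 in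
/-- **the same in the block-norm vocabulary of the Sect.-D bookkeeping** (r16's `B11SectG.HasMaj` between the sharp-block sup sizes
`BlockNorm.ofBlocks g blk`, conservative over [4] (2.51) by `B11SectG.hasMaj_of_hasMajorant`): EXACTLY the `hT'` input shape `θ′·e^{−δ d(a,b)}` of
`B9SectDL2Decay.rightEntry_majorant` / `entry_majorant` for the perturbation of the (3.138) expansion — here its `Δ⁽²⁾` summand (the projection
dressing `Δ⁽²⁾_π` of (3.136′) and `Δ′_π` are rows 3.122ff by reference). [cite: Balaban1985BackgroundPropagators, (3.137)–(3.138) p.423]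
[cite: Balaban1984PropagatorsII, (2.51)–(2.55) p.232] [cite: Balaban1985Variational, (73) p.289] -/
theorem hasMaj_delta2_calC_exp (hd : 2 ≤ d) (hJ : ∀ j ∈ lv, j ≤ k) (hw : ∀ j ∈ lv, ∀ c ∈ T j, 0 ≤ w j c)
    {c₀ M Me : ℝ} (hc₀ : 0 ≤ c₀ * M) (hMe : 0 ≤ Me) (he : ∀ i, ‖e i‖ ≤ Me)
    (hK : ∀ j ∈ lv, ∀ c ∈ T j, w j c * ‖K j c‖ ≤ c₀ * M * α₀ * ((L : ℝ) ^ j) ^ (d - 2))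
    {R δ : ℝ} (hδ : 0 ≤ δ)
    (hR : ∀ j ∈ lv, ∀ c ∈ T j, ∀ y y' : g.Site, BoxMeets L S blk j c y → BoxMeets L S blk j c y' → g.dist y y' ≤ R) :
    B11SectG.HasMaj (B11SectG.BlockNorm.ofBlocks g blk) (B11SectG.BlockNorm.ofBlocks g blk)
      (Matrix.mulVecLin (B9Delta2Def134.delta2 (calC L U₀ S lv T w K e τ)))
      (fun y y' => (2 * d * C3Gen d L * ‖τ‖ * (∑ i, ‖e i‖) * Me * c₀ * lv.card) * (M * α₀) * Real.exp (δ * R) *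
        Real.exp (-(δ * g.dist y y'))) := by
  have hE : 0 ≤ ∑ i, ‖e i‖ := Finset.sum_nonneg fun i _ => norm_nonneg _
  have hC := C3Gen_nonneg d L
  have hθ0 : ∀ y y' : g.Site, 0 ≤ (2 * d * C3Gen d L * ‖τ‖ * (∑ i, ‖e i‖) * Me * c₀ * lv.card) * (M * α₀) * Real.exp (δ * R) *
      Real.exp (-(δ * g.dist y y')) := fun y y' => by
    rw [show (2 * d * C3Gen d L * ‖τ‖ * (∑ i, ‖e i‖) * Me * c₀ * lv.card) * (M * α₀) * Real.exp (δ * R) *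
        Real.exp (-(δ * g.dist y y')) = 2 * d * C3Gen d L * ‖τ‖ * (∑ i, ‖e i‖) * Me * lv.card * (c₀ * M * α₀) *
        Real.exp (δ * R) * Real.exp (-(δ * g.dist y y')) by ring]
    have : 0 ≤ c₀ * M * α₀ := mul_nonneg hc₀ hα.le
    positivity
  exact B11SectG.hasMaj_of_hasMajorant blk hθ0
    (hasMajorant_delta2_calC_exp L hL hG k U₀ hU₀ hα hα3 hα4 h52 hb hsmall hc₃ h145 h155 S lv T w K e τ blk hd hJ hw hc₀ hMe he
      hK hδ hR)

end Majorant

end Literature.MathematicalPhysics.QuantumFieldTheory.Balaban1983to89.B9Eq3134MatrixConcrete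

end
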